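import Summits.Langlands.Langlands.Theses.SkinnerWilesDefectOne

/-!
# Disproof of `EisensteinProModularSeed` (stmt-Langlands-12920) — standing disprover's work file

Crux: `Summit.Langlands.Langlands.Theses.SkinnerWilesDefectOne.EisensteinProModularSeed`
(route SkinnerWilesDefectOne, rank 3, THE ENTRANCE): for `F` imaginary quadratic, `p` odd,
`O` the valuation ring of `ℚ̄_p`, every irreducible a.e.-unramified `ρ : Γ_F → GL₂(ℚ̄_p)` with a
residually upper-triangular integral model `ρ₀` (ordered residual pair `(χ̄_a, χ̄_b)`),
`p`-distinguished and ORIENTED-ordinary of one parallel weight `k ≥ 2` at every `v ∣ p`, admits a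
partner: a tame level `𝒰`, an IRREDUCIBLE `p`-adically automorphic `r` of level `𝒰` with an
integral model `r₀` having the SAME ordered residual diagonal, oriented-ordinary of some parallel
weight `k' ≥ 2`, and ONE auxiliary place `q` such that `𝒰` is hyperspecial at every `v ≠ q`,
`v ∤ p` where both residual characters are unramified.

**cdisprove gen 1, cycle 1 (2026-08-16). VERDICT: no kill; none is landable this epoch (§5 PINS);
on paper the statement is a STRENGTHENING of Skinner–Wiles step (II) (char-0, arithmetic
parallel weight, level raised at one place instead of a field change) that is TRUE for residual
pairs descending to `ℚ` and OPEN for genuine pairs.**  What this file offers is checked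
STRUCTURE for provers/planners and the attack log.

**cdisprove gen 3, cycle 1 (2026-08-16). VERDICT: no kill (same pins); stub census of the three lines finds no
cheap handle; new: dihedral exclusion, Combes' genuine parallel-type congruence (lit), and a computational
census of straight congruences for genuine pairs (§8).**

**cdisprove gen 2, cycle 1 (2026-08-16). VERDICT: still no kill (same pins), but two new STRUCTURAL
facts are now theorems and one mechanism is declared dead ON PAPER (§6–§7):**
(1) `seedNoLevel_of_engine` — delete the level clause and the seed IS the engine applied to `ρ`
(`r := ρ`): the ONE-`q` level clause is the seed's entire content; (2) `orientedFrame_diag_congr` /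
`concl_orientation_residual` (and the converse `oriented_of_unitRoot_congr`, the ideators' stub P1) —
the orientation inequality `‖Q₀₀‖ ≤ ‖Q₁₀‖` READS RESIDUALLY as
"`θ₁ ≡ (r₀)₁₁ = χ_b`, `θ₂ ≡ (r₀)₀₀ = χ_a (mod 𝔪)`": the ordinary (cyclotomic-like) sub-character
reduces to the residual QUOTIENT and the unit-root character to the residual SUB, at EVERY `v ∣ p`
(uses the pinning `O = 𝒪_{ℚ̄_p}`); (3) `concl_eisenstein_congruence` — `Concl` forces a continuous
`x : 𝕋(𝒰) → ℚ̄_p` with `x(T_{v,1})`, `q_v x(T_{v,2})` INTEGRAL and `≡ χ_a + χ_b`, `≡ χ_a χ_b` at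
Frobenius (the Eisenstein maximal ideal, arithmetic normalisation), next to an IRREDUCIBLE `r`
(`concl_witness_not_borel`: upper-triangular in no frame).  DEAD MECHANISM (§7): the item's own
"intended proof" — Berger's lower bound on the Eisenstein ideal by `L^alg(0, φ₁/φ₂)` — concerns
Harder's DEGREE-ONE Eisenstein classes, i.e. Hecke characters of infinity type `(z, z⁻¹)`
(arXiv:math/0701177 pp. 3, 8 read; Branchereau 2024 p. 2: type `(-2,0)`), whose congruent weight-2
cusp forms are NON-ordinary at inert `p` and carry the MIXED orientation at split `p = 𝔭𝔭̄`
(unit root `≡ pφ₁(𝔭)` at `𝔭`, loc. cit. p. 9, but `≡ φ₂(𝔭̄)` at `𝔭̄`) — excluded by (2) at one of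
the two places for every `p`-distinguished datum.  The typed (uniform, Skinner–Wiles) orientation is
that of the PARALLEL-type Eisenstein systems `(χ_a, χ_b N^{k'-1})` (`χ`'s of finite order), which live
in degrees 0 and 2 of Bianchi cohomology (Kostant: `w ∈ {1, s_σ s_σ̄}`), have no critical `L`-value
(finite-order characters of a totally complex field: `Γ_ℂ(s)` vanishing at `s ≤ 0`) and whose known
congruences are torsion (Eisenstein torsion at prime level) or geometric (base change / elliptic
curves) — exactly the two live ideator cards (`descend-raise-basechange`, `ell-switch-geometric-seed`).

## Findings index (everything is `lean check`ed; no `sorry`; axioms standard)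
* §0 `OrientedOrdinaryAt`, `OrientedOrdinary`, `Hyps`, `ResiduallyUnramifiedAt`, `DiagCongr`,
  `Concl`, `crux_iff_rebracketed` — the crux is verbatim `∀ data, Hyps ρ ρ₀ → Concl ρ₀`, and
  `Concl` NEVER MENTIONS `ρ`.
* §1 THE SEED FORGETS `ρ`: `concl_congr` (two integral data with congruent ordered diagonals have
  equivalent conclusions), `diagCongr_iff_residualDiag`, `residuallyUnramifiedAt_congr`,
  `isPDistinguishedAt_congr`, and `crux_iff_pairSeedArising` — the crux is EQUIVALENT to a
  statement about residual pairs `(χ̄_a, χ̄_b)` that ARISE from some admissible `ρ`; the continuous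
  irreducible ordinary `ρ` is only a certificate of relevance.  Consequence for provers: no
  hypothesis on `ρ` can be USED except through the pair; consequence for refuters: a counterexample
  is a PAIR with no level-`cond·q` Eisenstein-congruent char-0 ordinary point, certified by any `ρ`.
* §2 WHAT `Concl` FORCES: `isUnramifiedAt_of_isPadicallyAutomorphic`,
  `eventually_isUnramifiedAt_of_isPadicallyAutomorphic`, `exists_eigensystem_of_isPadicallyAutomorphic`
  (a CONTINUOUS ring map `𝕋(𝒰) → ℚ̄_p` with `charpoly r(Frob_v) = X² − x(T_{v,1})X + q_v x(T_{v,2})`),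
  `eigensystem_apply_eq_zero_of_nsmul_eq_zero` (briefing B1: such `x` kills torsion — torsion-only
  congruences give nothing as typed), `concl_level_control` (the partner `r` is UNRAMIFIED at every
  `v ≠ q`, `v ∤ p` off the residual conductor: level control is real, this is what separates the seed
  from the engine), `orientation_ne_zero` (the inequality `‖Q₀₀‖ ≤ ‖Q₁₀‖` forces `Q₁₀ ≠ 0`: genuine
  transversality, no junk frame), `isOrdinaryOfWeightAt_of_orientedOrdinaryAt`,
  `isPadicallyAutomorphic_conj_iff` (re-framing `r ↦ P r P⁻¹` is free on the automorphic side),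
  `orientation_mul_of_residuallyBorel` + `orientedOrdinaryAt_conj_of_residuallyBorel` (the orientation
  clause is invariant under exactly the integral residually-Borel frame changes — those preserving the
  residual flag and the ordered pair).
* §3 LOAD-BEARING ANALYSIS as implications between typed variants:
  `PairSeed → crux` (`crux_of_pairSeed`; ALL hypotheses on `ρ` deleted but continuity-through-`ρ`
  and `p`-distinguishedness: conjecturally equivalent in truth value, identical for the intended
  method — NO hypothesis on `ρ` is load-bearing), `crux → SeedFiniteAux` (`crux_imp_seedFiniteAux`;
  the planner's fallback with a finite auxiliary set), `SeedMinimal → crux` (`crux_of_seedMinimal`;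
  no auxiliary place — believed FALSE in the unit-`L`-value regime, so the one `q` IS load-bearing).
  No `_false_without_` theorem is provable: every variant's failure needs a non-existence theorem
  for pro-modular `r` (see §5).
* §4 `SeedNicePrime` — the Skinner–Wiles-faithful retyping (nice prime over a one-dimensional
  local domain of any characteristic, integrally oriented frame, `θ₁/θ₂` of infinite order on
  inertia), elaborating against `TameLevel.IsPadicallyAutomorphic` for general coefficients; the
  repair the 2026-08-15 refuter advisory asked for, ready for a planner.
* §5 Attack log, PINS (why `¬S` is not landable), regimes where a counterexample should be sought.

* §6 (gen 2) `SeedNoLevel`, `seedNoLevel_of_crux`, `seedNoLevel_of_engine` (ENGINE ⇒ seed-minus-level,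
  `r := ρ`), `levelClause_minimal_of_above_p`; `FramedRep.not_isIrreducible_of_stableLine`,
  `FramedRep.not_isIrreducible_of_conj_upperTriangular`, `concl_witness_not_borel` (no Borel-shaped /
  Eisenstein-point `r`); `entry_eq_of_integralModel`, `orientedFrame_diag_congr`,
  `concl_orientation_residual` (residual reading of the orientation: `θ̄₁ = χ̄_b`, `θ̄₂ = χ̄_a`);
  `mem_maximalIdeal_of_v_lt_one`, `oriented_of_unitRoot_congr`, `orientedOrdinaryAt_of_unitRoot_congr`
  (the CONVERSE — ideators' stub P1 proved: unit root `≡ χ̄_a` at one distinguished `σ` ⇒ oriented);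
  `pow_sub_pow_mem_maximalIdeal`, `orientedOrdinaryAt_inertial_type`, `concl_inertial_type` (inertial
  types: `χ̄_a|_{I_v}` of order `∣ m`, `χ̄_b|_{I_v} = ω^{k-1}·`(order `∣ m`) at every `v ∣ p`);
  `heckeFrobPoly_two_eq`, `trace_det_of_charpoly_eq_heckeFrobPoly`, `trace_det_frob_of_isAssociated`,
  `trace_det_eq_of_integralModel`, `trace_det_congr_of_diagCongr`, `concl_eisenstein_congruence`
  (the typed Eisenstein congruence: `x(T_{v,1}) ≡ χ_a+χ_b`, `q_v x(T_{v,2}) ≡ χ_aχ_b`, integral).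
* §7 (gen 2) attack log: orientation dichotomy (parallel = degrees 0/2 vs mixed = degree 1), why
  Berger-type congruences are dead for the typed clause, inert-`p` non-ordinarity, what a
  counterexample must look like now, literature read this cycle.
* §8 (gen 3) stub census of the three registered lines (no cheap kill; junk quantification in K1/D1
  harmless; R/S6 = crux restricted; `stub_window` = crux in cohomological clothing), dihedral exclusion,
  literature (Combes 2024: a GENUINE level-1 weight-12 form over `ℚ(√-11)` IS straight-Eisenstein-congruent
  mod 173 — corrects §7D; Fretwell–Roberts: local-origin congruences in print over `ℚ`/totally real only),
  and the first COMPUTATIONAL probe of the heart: a straight-congruence census for the smallest genuine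
  pairs over `ℚ(i)` and `ℚ(√-2)`, `p = 5` (kit j012985, j012986; design, controls, verdict logic, results);
  §8G: stub K1 (`stub_cousinSupply`) of `big-image-cousin` is FALSE as typed (Hasse obstruction at the two primes
  above 2 over `ℚ(√-7)`, `p = 7`; paper, evidence filed), and the ORPHAN datum `(1, ω)/ℚ(√-7)/p = 7` — served by
  no line — is RESCUED numerically by three level-169 newforms (`ℓ²`-raising at an inert `ℓ ≡ -1 mod p`; kit j013348).

No `-- Targets` this cycle (payload `targets`/`stuck_stubs` empty; no line picked yet).  Gen 1 proposed
nothing; gen 2 PROPOSED the reusable part of §6 under `Theorems/EisensteinProModularSeed/Negative/`: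
`OrientedFrame.lean` (p75384: `orientedFrame_diag_congr`, `oriented_of_unitRoot_congr`,
`inertial_type_of_orientedOrdinary`, `…_toLocal` forms) and `BorelAndEisenstein.lean` (p75392:
`not_isIrreducible_of_conj_upperTriangular`, `eisenstein_congruence_of_seed_conclusion`, trace/det
lemmas) — both ACCEPTED (tree commit b245999e72e3); import these (namespace
`Summit.Langlands.Langlands.Theorems.EisensteinProModularSeed.Negative`) rather than this work file.
-/

set_option linter.dupNamespace false

namespace Summit.Langlands.Langlands.Cruxes.EisensteinProModularSeed.Disproof

open Summit.Langlands.Langlands.Theses.SkinnerWilesDefectOne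
open Literature.NumberTheory.Automorphic Literature.NumberTheory.GaloisRepresentations
open Literature.NumberTheory.Automorphic.BigHeckeGLn
open NumberField IsDedekindDomain IsLocalRing Filter Field

/-! ## §0 Anatomy of the crux: `Hyps → Concl`, with `Concl` depending on `ρ₀` only -/

section Anatomy

variable {F : Type} [Field F] [NumberField F] (p : ℕ) [Fact p.Prime]
  (O : ValuationSubring (PadicAlgCl p))

/-- The ORIENTED ordinarity clause at `v` (weight `k`, inertial exponent `m`) shared by the
hypothesis (for `ρ`) and the conclusion (for `r`): a frame `Q` whose first column
`(Q₀₀, Q₁₀)` satisfies `‖Q₀₀‖ ≤ ‖Q₁₀‖` (the ordinary line reduces transversally to `e₀`) and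
in which `Q⁻¹ ρ|_{Γ_{F_v}} Q` is upper triangular with `θ₂^m = 1`, `θ₁^m = ε^{(k-1)m}` on
inertia. Verbatim the route's inline clause. [folklore] -/
def OrientedOrdinaryAt (r : FramedGaloisRep F (PadicAlgCl p) 2) (v : HeightOneSpectrum (𝓞 F))
    (k m : ℕ) : Prop :=
  ∃ Q : Matrix.GeneralLinearGroup (Fin 2) (PadicAlgCl p),
    Valued.v (Q.val 0 0) ≤ Valued.v (Q.val 1 0) ∧
    ∀ σ, (Q⁻¹ * r.toLocal v σ * Q).val 1 0 = 0 ∧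
      (σ ∈ absInertia (v.adicCompletion F) →
        (Q⁻¹ * r.toLocal v σ * Q).val 1 1 ^ m = 1 ∧
        (Q⁻¹ * r.toLocal v σ * Q).val 0 0 ^ m =
          algebraMap (Padic p) (PadicAlgCl p)
            (((GaloisRep.cyclotomicCharacter (v.adicCompletion F) p σ).val : PadicInt p) :
              Padic p) ^ ((k - 1) * m))

/-- Oriented-ordinary of ONE parallel weight `k ≥ 2` with one exponent `m > 0` at every `v ∣ p`
(the conclusion's local clause for `r`). [folklore] -/
def OrientedOrdinary (r : FramedGaloisRep F (PadicAlgCl p) 2) : Prop :=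
  ∃ k : ℕ, 2 ≤ k ∧ ∃ m : ℕ, 0 < m ∧ ∀ v : HeightOneSpectrum (𝓞 F),
    (p : 𝓞 F) ∈ v.asIdeal → OrientedOrdinaryAt p r v k m

/-- The HYPOTHESIS PACKAGE of the crux on `(ρ, ρ₀)`: irreducible, unramified a.e., `ρ₀` a
residually upper-triangular integral model in the same frame, and one `(k, m)` with
`p`-distinguishedness and oriented ordinarity at every `v ∣ p`. [folklore] -/
def Hyps (ρ : FramedGaloisRep F (PadicAlgCl p) 2)
    (ρ₀ : absoluteGaloisGroup F →* Matrix.GeneralLinearGroup (Fin 2) O) : Prop :=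
  ρ.toGaloisRep.IsIrreducible ∧ (∀ᶠ v in cofinite, ρ.IsUnramifiedAt v) ∧
    ρ.HasUpperTriangularIntegralModel ρ₀ ∧
    ∃ k : ℕ, 2 ≤ k ∧ ∃ m : ℕ, 0 < m ∧ ∀ v : HeightOneSpectrum (𝓞 F),
      (p : 𝓞 F) ∈ v.asIdeal → IsPDistinguishedAt ρ₀ v ∧ OrientedOrdinaryAt p ρ v k m

variable {p}

/-- "Both residual diagonal characters of `ρ₀` are unramified at `v`": every inertia group
above `v` has diagonal entries `≡ 1 (mod 𝔪)` (the route's inline clause). [folklore] -/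
def ResiduallyUnramifiedAt (ρ₀ : absoluteGaloisGroup F →* Matrix.GeneralLinearGroup (Fin 2) O)
    (v : HeightOneSpectrum (𝓞 F)) : Prop :=
  ∀ 𝔓 ∈ v.primesAbove, ∀ σ ∈ 𝔓.inertia (absoluteGaloisGroup F),
    ((ρ₀ σ).val 0 0 - 1 : O) ∈ maximalIdeal O ∧ ((ρ₀ σ).val 1 1 - 1 : O) ∈ maximalIdeal O

/-- "Same ORDERED residual diagonal": `(r₀ g)ᵢᵢ ≡ (ρ₀ g)ᵢᵢ (mod 𝔪)` for `i = 0, 1` and all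
`g` (the route's inline clause). [folklore] -/
def DiagCongr (r₀ ρ₀ : absoluteGaloisGroup F →* Matrix.GeneralLinearGroup (Fin 2) O) : Prop :=
  ∀ g, ((r₀ g).val 0 0 - (ρ₀ g).val 0 0 : O) ∈ maximalIdeal O ∧
    ((r₀ g).val 1 1 - (ρ₀ g).val 1 1 : O) ∈ maximalIdeal O

variable (p)

/-- The CONCLUSION of the crux. It mentions `ρ₀` only (never `ρ`), and `ρ₀` only through
`DiagCongr · ρ₀` and `ResiduallyUnramifiedAt O ρ₀`. [folklore] -/
def Concl (ρ₀ : absoluteGaloisGroup F →* Matrix.GeneralLinearGroup (Fin 2) O) : Prop :=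
  ∃ (𝒰 : TameLevel 2 F p) (r : FramedGaloisRep F (PadicAlgCl p) 2)
    (r₀ : absoluteGaloisGroup F →* Matrix.GeneralLinearGroup (Fin 2) O)
    (q : HeightOneSpectrum (𝓞 F)),
    r.toGaloisRep.IsIrreducible ∧ 𝒰.IsPadicallyAutomorphic r ∧
      r.HasUpperTriangularIntegralModel r₀ ∧ DiagCongr O r₀ ρ₀ ∧ OrientedOrdinary p r ∧
      ∀ v : HeightOneSpectrum (𝓞 F), v ≠ q → (p : 𝓞 F) ∉ v.asIdeal →
        ResiduallyUnramifiedAt O ρ₀ v → v ∉ 𝒰.bad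

end Anatomy

/-- The crux, re-bracketed: `∀ data, Hyps → Concl`. -/
def Rebracketed : Prop :=
  ∀ (F : Type) [Field F] [NumberField F], IsTotallyComplex F → Module.finrank ℚ F = 2 →
    ∀ (p : ℕ) [Fact p.Prime], p ≠ 2 → ∀ (O : ValuationSubring (PadicAlgCl p)),
      O = (Valued.v : Valuation (PadicAlgCl p) NNReal).valuationSubring →
      ∀ (ρ : FramedGaloisRep F (PadicAlgCl p) 2)
        (ρ₀ : absoluteGaloisGroup F →* Matrix.GeneralLinearGroup (Fin 2) O),
        Hyps p O ρ ρ₀ → Concl p O ρ₀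

/-- **Anatomy.** The crux is, verbatim up to bracketing, `∀ data, Hyps → Concl`. [folklore] -/
theorem crux_iff_rebracketed : EisensteinProModularSeed ↔ Rebracketed := by
  constructor
  · intro h F _ _ hF hdeg p _ hp O hO ρ ρ₀ hh
    obtain ⟨hirr, hunr, hmod, hloc⟩ := hh
    exact h F hF hdeg p hp O hO ρ ρ₀ hirr hunr hmod hloc
  · intro h F _ _ hF hdeg p _ hp O hO ρ ρ₀ hirr hunr hmod hloc
    exact h F hF hdeg p hp O hO ρ ρ₀ ⟨hirr, hunr, hmod, hloc⟩


/-! ## §1 The seed forgets `ρ`: the conclusion is a function of the residual pair only -/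

section Forgets

variable {F : Type} [Field F] {p : ℕ} [Fact p.Prime] {O : ValuationSubring (PadicAlgCl p)}

/-- `a ≡ b (mod 𝔪)` iff equal residues. [folklore] -/
theorem sub_mem_maximalIdeal_iff {a b : O} :
    a - b ∈ maximalIdeal O ↔ residue O a = residue O b := by
  rw [← residue_eq_zero_iff, map_sub, sub_eq_zero]

theorem DiagCongr.refl (ρ₀ : absoluteGaloisGroup F →* Matrix.GeneralLinearGroup (Fin 2) O) :
    DiagCongr O ρ₀ ρ₀ := fun g => by simp

theorem DiagCongr.symm {r₀ ρ₀ : absoluteGaloisGroup F →* Matrix.GeneralLinearGroup (Fin 2) O}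
    (h : DiagCongr O r₀ ρ₀) : DiagCongr O ρ₀ r₀ := fun g =>
  ⟨sub_mem_maximalIdeal_iff.mpr (sub_mem_maximalIdeal_iff.mp (h g).1).symm,
    sub_mem_maximalIdeal_iff.mpr (sub_mem_maximalIdeal_iff.mp (h g).2).symm⟩

theorem DiagCongr.trans {r₀ ρ₀ s₀ : absoluteGaloisGroup F →* Matrix.GeneralLinearGroup (Fin 2) O}
    (h : DiagCongr O r₀ ρ₀) (h' : DiagCongr O ρ₀ s₀) : DiagCongr O r₀ s₀ := fun g =>
  ⟨sub_mem_maximalIdeal_iff.mpr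
      ((sub_mem_maximalIdeal_iff.mp (h g).1).trans (sub_mem_maximalIdeal_iff.mp (h' g).1)),
    sub_mem_maximalIdeal_iff.mpr
      ((sub_mem_maximalIdeal_iff.mp (h g).2).trans (sub_mem_maximalIdeal_iff.mp (h' g).2))⟩

/-- `DiagCongr` is the statement that the residual diagonal entries (`residualDiag`, values in
the residue field `κ = O/𝔪`) of `r₀` and `ρ₀` coincide as functions on `Γ_F`. [folklore] -/
theorem diagCongr_iff_residualDiag
    (r₀ ρ₀ : absoluteGaloisGroup F →* Matrix.GeneralLinearGroup (Fin 2) O) :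
    DiagCongr O r₀ ρ₀ ↔
      residualDiag r₀ 0 = residualDiag ρ₀ 0 ∧ residualDiag r₀ 1 = residualDiag ρ₀ 1 := by
  simp only [DiagCongr, funext_iff, residualDiag, sub_mem_maximalIdeal_iff]
  exact ⟨fun h => ⟨fun g => (h g).1, fun g => (h g).2⟩, fun h g => ⟨h.1 g, h.2 g⟩⟩

/-- Residual unramifiedness of the diagonal is invariant under `DiagCongr`. [folklore] -/
theorem residuallyUnramifiedAt_congr
    {r₀ ρ₀ : absoluteGaloisGroup F →* Matrix.GeneralLinearGroup (Fin 2) O}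
    (h : DiagCongr O r₀ ρ₀) (v : HeightOneSpectrum (𝓞 F)) :
    ResiduallyUnramifiedAt O r₀ v ↔ ResiduallyUnramifiedAt O ρ₀ v := by
  refine forall₂_congr fun 𝔓 _ => forall₂_congr fun σ _ => ?_
  have h1 := sub_mem_maximalIdeal_iff.mp (h σ).1
  have h2 := sub_mem_maximalIdeal_iff.mp (h σ).2
  rw [sub_mem_maximalIdeal_iff, sub_mem_maximalIdeal_iff, sub_mem_maximalIdeal_iff,
    sub_mem_maximalIdeal_iff, h1, h2]

variable [NumberField F]

/-- `p`-distinguishedness is invariant under `DiagCongr` (so the `r₀` of the conclusion is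
automatically `p`-distinguished wherever `ρ₀` is). [folklore] -/
theorem isPDistinguishedAt_congr
    {r₀ ρ₀ : absoluteGaloisGroup F →* Matrix.GeneralLinearGroup (Fin 2) O}
    (h : DiagCongr O r₀ ρ₀) (v : HeightOneSpectrum (𝓞 F)) :
    IsPDistinguishedAt r₀ v ↔ IsPDistinguishedAt ρ₀ v := by
  obtain ⟨h0, h1⟩ := (diagCongr_iff_residualDiag r₀ ρ₀).mp h
  simp only [IsPDistinguishedAt, h0, h1]

variable (p) in
/-- **The seed forgets `ρ`.** The conclusion depends on `ρ₀` only through its ORDERED residual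
diagonal pair: two integral models with congruent diagonals have equivalent conclusions
(transitivity of `DiagCongr` for the residual clause, `residuallyUnramifiedAt_congr` for the
level clause). In particular every hypothesis on `ρ` (irreducibility, a.e.-unramifiedness,
ordinarity, orientation, the weight `k`) enters the crux ONLY by restricting which residual
pairs occur. [folklore] -/
theorem concl_congr {ρ₀ ρ₀' : absoluteGaloisGroup F →* Matrix.GeneralLinearGroup (Fin 2) O}
    (h : DiagCongr O ρ₀ ρ₀') : Concl p O ρ₀ ↔ Concl p O ρ₀' := by
  constructor
  · rintro ⟨𝒰, r, r₀, q, hirr, hpa, hmod, hdiag, hord, hlev⟩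
    exact ⟨𝒰, r, r₀, q, hirr, hpa, hmod, hdiag.trans h, hord,
      fun v hvq hvp hur => hlev v hvq hvp ((residuallyUnramifiedAt_congr h v).mpr hur)⟩
  · rintro ⟨𝒰, r, r₀, q, hirr, hpa, hmod, hdiag, hord, hlev⟩
    exact ⟨𝒰, r, r₀, q, hirr, hpa, hmod, hdiag.trans h.symm, hord,
      fun v hvq hvp hur => hlev v hvq hvp ((residuallyUnramifiedAt_congr h v).mp hur)⟩

variable (p O) in
/-- A residual datum `ρ₀'` **arises** if some admissible `(ρ, ρ₀)` (i.e. satisfying `Hyps`) has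
the same ordered residual diagonal. -/
def Arises (ρ₀' : absoluteGaloisGroup F →* Matrix.GeneralLinearGroup (Fin 2) O) : Prop :=
  ∃ (ρ : FramedGaloisRep F (PadicAlgCl p) 2)
    (ρ₀ : absoluteGaloisGroup F →* Matrix.GeneralLinearGroup (Fin 2) O),
    Hyps p O ρ ρ₀ ∧ DiagCongr O ρ₀ ρ₀'

end Forgets

/-- The crux as a statement about residual pairs: `Arises → Concl`. -/
def PairSeedArising : Prop :=
  ∀ (F : Type) [Field F] [NumberField F], IsTotallyComplex F → Module.finrank ℚ F = 2 →
    ∀ (p : ℕ) [Fact p.Prime], p ≠ 2 → ∀ (O : ValuationSubring (PadicAlgCl p)),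
      O = (Valued.v : Valuation (PadicAlgCl p) NNReal).valuationSubring →
      ∀ (ρ₀' : absoluteGaloisGroup F →* Matrix.GeneralLinearGroup (Fin 2) O),
        Arises p O ρ₀' → Concl p O ρ₀'

/-- **The crux is a statement about residual pairs.** `EisensteinProModularSeed` is equivalent
to: every residual datum that ARISES from an admissible `(ρ, ρ₀)` has the conclusion. The
continuous irreducible ordinary `ρ` is a CERTIFICATE that the pair is relevant to the engine,
nothing more. [folklore] -/
theorem crux_iff_pairSeedArising : EisensteinProModularSeed ↔ PairSeedArising := by
  rw [crux_iff_rebracketed]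
  constructor
  · rintro h F _ _ hF hdeg p _ hp O hO ρ₀' ⟨ρ, ρ₀, hh, hcongr⟩
    exact (concl_congr p hcongr).mp (h F hF hdeg p hp O hO ρ ρ₀ hh)
  · intro h F _ _ hF hdeg p _ hp O hO ρ ρ₀ hh
    exact h F hF hdeg p hp O hO ρ₀ ⟨ρ, ρ₀, hh, DiagCongr.refl ρ₀⟩


/-! ## §2 What the conclusion forces (everything a prover must deliver, unfolded) -/

section Forces

variable {F : Type} [Field F] [NumberField F] {p : ℕ} [Fact p.Prime]
  {O : ValuationSubring (PadicAlgCl p)}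

/-- A `p`-adically automorphic `r` of tame level `𝒰` is unramified at every `v ∉ 𝒰.bad`
(first conjunct of `IsAssociatedFamily`). [folklore] -/
theorem isUnramifiedAt_of_isPadicallyAutomorphic {𝒰 : TameLevel 2 F p}
    {r : FramedGaloisRep F (PadicAlgCl p) 2} (h : 𝒰.IsPadicallyAutomorphic r)
    {v : HeightOneSpectrum (𝓞 F)} (hv : v ∉ 𝒰.bad) : r.IsUnramifiedAt v := by
  obtain ⟨x, -, hx⟩ := h
  exact (hx v hv).1

/-- … hence unramified almost everywhere (`𝒰.bad` is finite): the hypothesis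
`∀ᶠ v in cofinite, ρ.IsUnramifiedAt v` of the crux is exactly what pro-modularity of `ρ`
would give back. [folklore] -/
theorem eventually_isUnramifiedAt_of_isPadicallyAutomorphic {𝒰 : TameLevel 2 F p}
    {r : FramedGaloisRep F (PadicAlgCl p) 2} (h : 𝒰.IsPadicallyAutomorphic r) :
    ∀ᶠ v in cofinite, r.IsUnramifiedAt v :=
  Filter.eventually_cofinite.mpr
    (𝒰.bad_finite.subset fun _ hv =>
      not_not.mp fun hvb => hv (isUnramifiedAt_of_isPadicallyAutomorphic h hvb))

/-- A `p`-adically automorphic `r` carries a CONTINUOUS `ℚ̄_p`-valued eigensystem `x` of the big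
Hecke algebra with `charpoly r(Frob_v) = X² − x(T_{v,1}) X + q_v x(T_{v,2})` at every good `v`
(arithmetic Frobenius). Unfolding only; recorded so that provers see the exact deliverable:
a characteristic-ZERO point (`x` is a ring map into a field of characteristic `0`, so it kills
all `ℤ_p`-torsion of `𝕋(𝒰)` — torsion-only Eisenstein congruences give no such `x`; briefing B1
of the 2026-08-15 refuter note). [folklore] -/
theorem exists_eigensystem_of_isPadicallyAutomorphic {𝒰 : TameLevel 2 F p}
    {r : FramedGaloisRep F (PadicAlgCl p) 2} (h : 𝒰.IsPadicallyAutomorphic r) :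
    ∃ x : CompletedCohomologyHeckeAlgebraGLn 𝒰 →+* PadicAlgCl p, Continuous x ∧
      ∀ v ∉ 𝒰.bad, r.IsUnramifiedAt v ∧
        r.HasFrobCharpolyAt v (heckeFrobPoly 2 (Ideal.absNorm v.asIdeal) fun i => x (𝒰.heckeT v i)) :=
  h

/-- **Briefing B1 as a lemma: `ℚ̄_p`-valued eigensystems kill torsion.** A ring map from the
big Hecke algebra to `ℚ̄_p` (characteristic zero) annihilates every additively torsion element;
so a Hecke eigensystem carried ONLY by `ℤ_p`-torsion classes of the Bianchi tower yields no point
`x` as required by `IsPadicallyAutomorphic` over `PadicAlgCl p` — "torsion classes allowed" in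
the item's intended-proof text does not help as typed. [folklore] -/
theorem eigensystem_apply_eq_zero_of_nsmul_eq_zero {𝒰 : TameLevel 2 F p}
    (x : CompletedCohomologyHeckeAlgebraGLn 𝒰 →+* PadicAlgCl p)
    {t : CompletedCohomologyHeckeAlgebraGLn 𝒰} {n : ℕ} (hn : n ≠ 0) (ht : n • t = 0) :
    x t = 0 := by
  have h := congrArg x ht
  rw [map_nsmul, map_zero, nsmul_eq_mul, mul_eq_zero] at h
  exact h.resolve_left (Nat.cast_ne_zero.mpr hn)

variable (p O) in
/-- **Level control is real.** The conclusion forces its `r` to be UNRAMIFIED at every finite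
place `v ≠ q`, `v ∤ p`, at which both residual characters of `ρ₀` are unramified — i.e. `r` has
tame conductor dividing `cond(χ̄_a) cond(χ̄_b) · q^∞`. This is what separates the seed from the
engine applied to `ρ` itself (`ρ` may ramify anywhere). [folklore] -/
theorem concl_level_control {ρ₀ : absoluteGaloisGroup F →* Matrix.GeneralLinearGroup (Fin 2) O}
    (h : Concl p O ρ₀) :
    ∃ (r : FramedGaloisRep F (PadicAlgCl p) 2)
      (r₀ : absoluteGaloisGroup F →* Matrix.GeneralLinearGroup (Fin 2) O)
      (q : HeightOneSpectrum (𝓞 F)),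
      r.toGaloisRep.IsIrreducible ∧ (∃ 𝒰 : TameLevel 2 F p, 𝒰.IsPadicallyAutomorphic r) ∧
        r.HasUpperTriangularIntegralModel r₀ ∧ DiagCongr O r₀ ρ₀ ∧ OrientedOrdinary p r ∧
        ∀ v : HeightOneSpectrum (𝓞 F), v ≠ q → (p : 𝓞 F) ∉ v.asIdeal →
          ResiduallyUnramifiedAt O ρ₀ v → r.IsUnramifiedAt v := by
  obtain ⟨𝒰, r, r₀, q, hirr, hpa, hmod, hdiag, hord, hlev⟩ := h
  exact ⟨r, r₀, q, hirr, ⟨𝒰, hpa⟩, hmod, hdiag, hord,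
    fun v hvq hvp hur => isUnramifiedAt_of_isPadicallyAutomorphic hpa (hlev v hvq hvp hur)⟩

/-- The orientation inequality `‖Q₀₀‖ ≤ ‖Q₁₀‖` forces `Q₁₀ ≠ 0` (else the first column of the
invertible `Q` vanishes): the ordinary line `ℚ̄_p · Q e₀` is never the coordinate line `e₀`, and
its integral generator `(Q₀₀/Q₁₀, 1)` reduces OUTSIDE the residual sub-line `⟨ē₀⟩` — the
inequality is genuine transversality, not satisfiable by junk. [folklore] -/
theorem orientation_ne_zero (Q : Matrix.GeneralLinearGroup (Fin 2) (PadicAlgCl p))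
    (hQ : Valued.v (Q.val 0 0) ≤ Valued.v (Q.val 1 0)) : Q.val 1 0 ≠ 0 := by
  intro h10
  have h00 : Q.val 0 0 = 0 := by
    rw [h10, map_zero, nonpos_iff_eq_zero, map_eq_zero] at hQ
    exact hQ
  have hdet : Q.val.det = 0 := by
    rw [Matrix.det_fin_two, h00, h10]; ring
  have hne : Q.val.det ≠ 0 := by
    rw [← Matrix.GeneralLinearGroup.val_det_apply]
    exact (Matrix.GeneralLinearGroup.det Q).ne_zero
  exact hne hdet

omit [NumberField F] in
/-- Forgetting the orientation: the oriented clause implies `IsOrdinaryOfWeightAt` (the tree's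
predicate; `isOrdinaryOfWeightAt_iff_padicAlgCl`), as used by the route's `closes`. [folklore] -/
theorem isOrdinaryOfWeightAt_of_orientedOrdinaryAt [NumberField F]
    {r : FramedGaloisRep F (PadicAlgCl p) 2} {v : HeightOneSpectrum (𝓞 F)} {k m : ℕ}
    (h : OrientedOrdinaryAt p r v k m) : r.IsOrdinaryOfWeightAt p v k m := by
  obtain ⟨Q, -, hQ⟩ := h
  exact (FramedGaloisRep.isOrdinaryOfWeightAt_iff_padicAlgCl p r v k m).mpr ⟨Q, hQ⟩


omit [NumberField F] in
/-- Frobenius characteristic polynomials are invariant under change of frame (Mathlib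
`Matrix.charpoly_units_conj`; cf. `ReciprocityGLnProofs`, not imported here). [folklore] -/
theorem hasFrobCharpolyAt_conj_iff' (v : HeightOneSpectrum (𝓞 F))
    (P : Matrix.GeneralLinearGroup (Fin 2) (PadicAlgCl p)) (f : Polynomial (PadicAlgCl p))
    (r : FramedGaloisRep F (PadicAlgCl p) 2) :
    FramedGaloisRep.HasFrobCharpolyAt v f (FramedRep.conj P r) ↔ r.HasFrobCharpolyAt v f := by
  refine forall₂_congr fun 𝔓 _ => forall₂_congr fun σ _ => ?_
  have h : FramedRep.charpoly (FramedRep.conj P r) σ = FramedRep.charpoly r σ := by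
    simp only [FramedRep.charpoly, FramedRep.conj_apply, Units.val_mul, Matrix.coe_units_inv]
    exact Matrix.charpoly_units_conj P _
  rw [h]

/-- **Re-framing is free on the automorphic side.** `p`-adic automorphy of tame level `𝒰` is
invariant under change of frame `r ↦ P r P⁻¹` (unramifiedness and Frobenius characteristic
polynomials are class functions): provers may conjugate a pro-modular `r` into a frame where its
stable lattice is residually upper-triangular with the wanted ORDER (Ribet's lemma) without
losing `IsPadicallyAutomorphic`. (The orientation clause is NOT frame-invariant: it refers to the
frame of `r₀`.) [folklore] -/
theorem isPadicallyAutomorphic_conj_iff {𝒰 : TameLevel 2 F p}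
    (P : Matrix.GeneralLinearGroup (Fin 2) (PadicAlgCl p)) (r : FramedGaloisRep F (PadicAlgCl p) 2) :
    𝒰.IsPadicallyAutomorphic (FramedRep.conj P r) ↔ 𝒰.IsPadicallyAutomorphic r := by
  refine exists_congr fun x => and_congr Iff.rfl (forall₂_congr fun v _ => ?_)
  rw [FramedGaloisRep.isUnramifiedAt_conj_iff, hasFrobCharpolyAt_conj_iff']


/-- **Which re-framings keep the orientation.** If `P` is integral and RESIDUALLY BOREL
(`‖P₀₀‖, ‖P₀₁‖ ≤ 1`, `‖P₁₀‖ < 1`, `‖P₁₁‖ = 1` — an integral change of frame preserving the residual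
flag `⟨ē₀⟩`, hence the residual upper-triangularity of an integral model and its ordered diagonal)
and the first column of `Q` is oriented (`‖Q₀₀‖ ≤ ‖Q₁₀‖`), then the first column of `P Q` is
oriented.  So the orientation clause is invariant under exactly the frame changes that keep `r₀`
residually upper-triangular with the same ordered pair (ultrametric inequality). [folklore] -/
theorem orientation_mul_of_residuallyBorel (P Q : Matrix.GeneralLinearGroup (Fin 2) (PadicAlgCl p))
    (hP00 : Valued.v (P.val 0 0) ≤ 1) (hP01 : Valued.v (P.val 0 1) ≤ 1)
    (hP10 : Valued.v (P.val 1 0) < 1) (hP11 : Valued.v (P.val 1 1) = 1)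
    (hQ : Valued.v (Q.val 0 0) ≤ Valued.v (Q.val 1 0)) :
    Valued.v ((P * Q).val 0 0) ≤ Valued.v ((P * Q).val 1 0) := by
  have hQ10 : Q.val 1 0 ≠ 0 := orientation_ne_zero Q hQ
  have hQ10pos : 0 < Valued.v (Q.val 1 0) := by
    rw [pos_iff_ne_zero]
    exact (Valuation.ne_zero_iff _).mpr hQ10
  have e10 : (P * Q).val 1 0 = P.val 1 0 * Q.val 0 0 + P.val 1 1 * Q.val 1 0 := by
    simp [Units.val_mul, Matrix.mul_apply, Fin.sum_univ_two]
  have e00 : (P * Q).val 0 0 = P.val 0 0 * Q.val 0 0 + P.val 0 1 * Q.val 1 0 := by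
    simp [Units.val_mul, Matrix.mul_apply, Fin.sum_univ_two]
  -- the (1,0) entry has valuation exactly `‖Q₁₀‖`
  have h1 : Valued.v (P.val 1 0 * Q.val 0 0) < Valued.v (P.val 1 1 * Q.val 1 0) := by
    rw [map_mul, map_mul, hP11, one_mul]
    by_cases h0 : Valued.v (Q.val 0 0) = 0
    · rw [h0, mul_zero]; exact hQ10pos
    · exact lt_of_lt_of_le (mul_lt_of_lt_one_left (pos_iff_ne_zero.mpr h0) hP10) hQ
  have h10 : Valued.v ((P * Q).val 1 0) = Valued.v (Q.val 1 0) := by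
    rw [e10, Valuation.map_add_eq_of_lt_right _ h1, map_mul, hP11, one_mul]
  -- the (0,0) entry has valuation at most `‖Q₁₀‖`
  have h00 : Valued.v ((P * Q).val 0 0) ≤ Valued.v (Q.val 1 0) := by
    rw [e00]
    refine Valuation.map_add_le _ ?_ ?_
    · rw [map_mul]
      exact le_trans (mul_le_of_le_one_left zero_le hP00) hQ
    · rw [map_mul]
      exact mul_le_of_le_one_left zero_le hP01
  rw [h10]
  exact h00

/-- **Oriented ordinarity transports along residually-Borel integral re-framings**: if `r` is
oriented-ordinary at `v` in weight `(k, m)` and `P` is integral residually Borel, then so is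
`P r P⁻¹` (new frame `P Q`). Together with `isPadicallyAutomorphic_conj_iff` this says the whole
conclusion `Concl` is insensitive to such frame changes. [folklore] -/
theorem orientedOrdinaryAt_conj_of_residuallyBorel {r : FramedGaloisRep F (PadicAlgCl p) 2}
    {v : HeightOneSpectrum (𝓞 F)} {k m : ℕ} (P : Matrix.GeneralLinearGroup (Fin 2) (PadicAlgCl p))
    (hP00 : Valued.v (P.val 0 0) ≤ 1) (hP01 : Valued.v (P.val 0 1) ≤ 1)
    (hP10 : Valued.v (P.val 1 0) < 1) (hP11 : Valued.v (P.val 1 1) = 1)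
    (h : OrientedOrdinaryAt p r v k m) : OrientedOrdinaryAt p (FramedRep.conj P r) v k m := by
  obtain ⟨Q, hQ, hQσ⟩ := h
  refine ⟨P * Q, orientation_mul_of_residuallyBorel P Q hP00 hP01 hP10 hP11 hQ, fun σ => ?_⟩
  have e : (P * Q)⁻¹ * FramedGaloisRep.toLocal v (FramedRep.conj P r) σ * (P * Q) =
      Q⁻¹ * r.toLocal v σ * Q := by
    rw [FramedGaloisRep.toLocal_conj, FramedRep.conj_apply]; group
  rw [e]
  exact hQσ σ

end Forces

/-! ## §3 Load-bearing analysis: which hypotheses on `ρ` matter? (none, beyond "which pairs") -/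

/-- **`PairSeed`** — the crux with EVERY hypothesis on `ρ` deleted except that `ρ₀` is a
residually upper-triangular integral model of SOME continuous `ρ` (this keeps the residual
characters continuous and is needed: see `PairSeedDiscontinuous` below) and `p`-distinguishedness
at `v ∣ p`: "every continuous residually upper-triangular, `p`-distinguished datum over an
imaginary quadratic field has a level-`cond·q` irreducible oriented-ordinary pro-modular partner".
Irreducibility, a.e.-unramifiedness, ordinarity, orientation and the weight of `ρ` are GONE; e.g.
`ρ = χ_a ⊕ χ_b` itself is allowed.  PAPER VERDICT: conjecturally EQUIVALENT to the crux in truth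
value (every `p`-distinguished continuous pair should arise from some admissible irreducible `ρ`,
e.g. a CM or base-change cusp form — unprovable here either way); the intended proof (Eisenstein
cohomology class for `(χ_a, χ_b)` + congruence) proves `PairSeed` whenever it proves the crux,
because it never looks at `ρ`.  So NO hypothesis on `ρ` is load-bearing for the METHOD. -/
def PairSeed : Prop :=
  ∀ (F : Type) [Field F] [NumberField F], IsTotallyComplex F → Module.finrank ℚ F = 2 →
    ∀ (p : ℕ) [Fact p.Prime], p ≠ 2 → ∀ (O : ValuationSubring (PadicAlgCl p)),
      O = (Valued.v : Valuation (PadicAlgCl p) NNReal).valuationSubring →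
      ∀ (ρ : FramedGaloisRep F (PadicAlgCl p) 2)
        (ρ₀ : absoluteGaloisGroup F →* Matrix.GeneralLinearGroup (Fin 2) O),
        ρ.HasUpperTriangularIntegralModel ρ₀ →
        (∀ v : HeightOneSpectrum (𝓞 F), (p : 𝓞 F) ∈ v.asIdeal → IsPDistinguishedAt ρ₀ v) →
        Concl p O ρ₀

/-- `PairSeed` implies the crux (it is the crux with hypotheses deleted). [folklore] -/
theorem crux_of_pairSeed (h : PairSeed) : EisensteinProModularSeed := by
  rw [crux_iff_rebracketed]
  intro F _ _ hF hdeg p _ hp O hO ρ ρ₀ hh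
  obtain ⟨-, -, hmod, k, -, m, -, hloc⟩ := hh
  exact h F hF hdeg p hp O hO ρ ρ₀ hmod fun v hv => (hloc v hv).1

/-- **`SeedFiniteAux`** — the planner's declared fallback (KILL CRITERIA of the route: "restate
with a finite set of level-raising places instead of one q"): same as the crux but the level is
hyperspecial only off `p`, off the residual conductor and off a FINITE SET `T` of auxiliary
places. Weaker than the crux (`crux_imp_seedFiniteAux`). PAPER VERDICT: this is the shape the
Galois-cohomological and automorphic heuristics actually support without case analysis; still
not in print over imaginary quadratic `F`. -/
def SeedFiniteAux : Prop :=
  ∀ (F : Type) [Field F] [NumberField F], IsTotallyComplex F → Module.finrank ℚ F = 2 →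
    ∀ (p : ℕ) [Fact p.Prime], p ≠ 2 → ∀ (O : ValuationSubring (PadicAlgCl p)),
      O = (Valued.v : Valuation (PadicAlgCl p) NNReal).valuationSubring →
      ∀ (ρ : FramedGaloisRep F (PadicAlgCl p) 2)
        (ρ₀ : absoluteGaloisGroup F →* Matrix.GeneralLinearGroup (Fin 2) O),
        Hyps p O ρ ρ₀ →
        ∃ (𝒰 : TameLevel 2 F p) (r : FramedGaloisRep F (PadicAlgCl p) 2)
          (r₀ : absoluteGaloisGroup F →* Matrix.GeneralLinearGroup (Fin 2) O)
          (T : Finset (HeightOneSpectrum (𝓞 F))),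
          r.toGaloisRep.IsIrreducible ∧ 𝒰.IsPadicallyAutomorphic r ∧
            r.HasUpperTriangularIntegralModel r₀ ∧ DiagCongr O r₀ ρ₀ ∧ OrientedOrdinary p r ∧
            ∀ v : HeightOneSpectrum (𝓞 F), v ∉ T → (p : 𝓞 F) ∉ v.asIdeal →
              ResiduallyUnramifiedAt O ρ₀ v → v ∉ 𝒰.bad

/-- The crux implies its finite-auxiliary-set weakening (`T = {q}`). [folklore] -/
theorem crux_imp_seedFiniteAux (h : EisensteinProModularSeed) : SeedFiniteAux := by
  rw [crux_iff_rebracketed] at h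
  intro F _ _ hF hdeg p _ hp O hO ρ ρ₀ hh
  obtain ⟨𝒰, r, r₀, q, hirr, hpa, hmod, hdiag, hord, hlev⟩ := h F hF hdeg p hp O hO ρ ρ₀ hh
  refine ⟨𝒰, r, r₀, {q}, hirr, hpa, hmod, hdiag, hord, fun v hvT hvp hur => ?_⟩
  exact hlev v (fun hvq => hvT (Finset.mem_singleton.mpr hvq)) hvp hur

/-- **`SeedMinimal`** — the natural STRENGTHENING with NO auxiliary place (tame level = residual
conductor). Implies the crux (`crux_of_seedMinimal`). PAPER VERDICT: believed FALSE in the regime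
"`p ∤ L^alg(0, χ_aχ_b⁻¹·)` and no `v ∣ cond` with `χ̄ω|_{D_v} = 1`": then the Greenberg–Wiles
count gives NO residual extension class of `χ̄_b` by `χ̄_a` split at `v ∣ p` and unramified off
`cond·p` unless the dual Selmer group of `χ̄ω` is non-zero, which is governed by the `L`-value
(Berger 2009 lower bound + main-conjecture upper bound); over `ℚ` the analogue fails by Mazur
(no level-one / level-`p` Eisenstein congruence for regular `p`). Not refutable in Lean (needs a
non-existence theorem for pro-modular `r`). The auxiliary `q` is LOAD-BEARING. -/
def SeedMinimal : Prop :=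
  ∀ (F : Type) [Field F] [NumberField F], IsTotallyComplex F → Module.finrank ℚ F = 2 →
    ∀ (p : ℕ) [Fact p.Prime], p ≠ 2 → ∀ (O : ValuationSubring (PadicAlgCl p)),
      O = (Valued.v : Valuation (PadicAlgCl p) NNReal).valuationSubring →
      ∀ (ρ : FramedGaloisRep F (PadicAlgCl p) 2)
        (ρ₀ : absoluteGaloisGroup F →* Matrix.GeneralLinearGroup (Fin 2) O),
        Hyps p O ρ ρ₀ →
        ∃ (𝒰 : TameLevel 2 F p) (r : FramedGaloisRep F (PadicAlgCl p) 2)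
          (r₀ : absoluteGaloisGroup F →* Matrix.GeneralLinearGroup (Fin 2) O),
          r.toGaloisRep.IsIrreducible ∧ 𝒰.IsPadicallyAutomorphic r ∧
            r.HasUpperTriangularIntegralModel r₀ ∧ DiagCongr O r₀ ρ₀ ∧ OrientedOrdinary p r ∧
            ∀ v : HeightOneSpectrum (𝓞 F), (p : 𝓞 F) ∉ v.asIdeal →
              ResiduallyUnramifiedAt O ρ₀ v → v ∉ 𝒰.bad

/-- A number field has a finite place. [folklore] -/
theorem nonempty_heightOneSpectrum (F : Type) [Field F] [NumberField F] :
    Nonempty (HeightOneSpectrum (𝓞 F)) := by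
  obtain ⟨M, hM⟩ := Ideal.exists_maximal (𝓞 F)
  exact ⟨⟨M, hM.isPrime, Ring.ne_bot_of_isMaximal_of_not_isField hM (RingOfIntegers.not_isField F)⟩⟩

/-- The minimal-level strengthening implies the crux (any `q` will do). [folklore] -/
theorem crux_of_seedMinimal (h : SeedMinimal) : EisensteinProModularSeed := by
  rw [crux_iff_rebracketed]
  intro F _ _ hF hdeg p _ hp O hO ρ ρ₀ hh
  obtain ⟨𝒰, r, r₀, hirr, hpa, hmod, hdiag, hord, hlev⟩ := h F hF hdeg p hp O hO ρ ρ₀ hh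
  obtain ⟨q⟩ := nonempty_heightOneSpectrum F
  exact ⟨𝒰, r, r₀, q, hirr, hpa, hmod, hdiag, hord, fun v _ hvp hur => hlev v hvp hur⟩


/-! ## §4 The Skinner–Wiles-faithful shape (repair template; elaborates, no theorem claimed) -/

/-- **`SeedNicePrime`** — what Skinner–Wiles' step (II) ACTUALLY outputs, typed over the tree's
general-coefficient vocabulary (`TameLevel.IsPadicallyAutomorphic` for any topological ring):
a NICE PRIME, i.e. a pro-modular deformation with values in a ONE-DIMENSIONAL LOCAL DOMAIN `A`
(SW99 §2.3, p. 18 of the IHÉS text: "A is a one-dimensional domain of characteristic p, ρ is a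
deformation of type 𝒟, ψ₁ψ₂⁻¹|_{I_v} of infinite order"; §4.2 p. 63: nice primes of `𝕋_𝒟^r`),
irreducible over `Frac A`, residually the ordered pair of `ρ₀` (through a local map
`φ : O → A`), nearly ordinary at `v ∣ p` in an INTEGRALLY ORIENTED frame (`Q ∈ GL₂(A)`,
`Q₁₀ ∈ Aˣ`: the ordinary line reduces outside `⟨ē₀⟩`) with `θ₁/θ₂` of infinite order on
inertia, tame level as in the crux.  Compared with the crux: NO characteristic-zero field, NO
arithmetic parallel weight, NO finite-order inertial characters — so torsion/boundary
phenomena of Bianchi cohomology are not excluded a priori and Calegari–Mazur sparsity of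
classical points is irrelevant.  Neither implication with the crux is formal (crux ⇒ this needs
`ringKrullDim O = 1` for the valuation ring of `ℚ̄_p` and "ε|_{I_v} has infinite order";
this ⇒ crux is false on paper).  Recorded for the planner (the 2026-08-15 refuter advisory asked
for exactly this retyping); it elaborates against the landed vocabulary. -/
def SeedNicePrime : Prop :=
  ∀ (F : Type) [Field F] [NumberField F], IsTotallyComplex F → Module.finrank ℚ F = 2 →
    ∀ (p : ℕ) [Fact p.Prime], p ≠ 2 → ∀ (O : ValuationSubring (PadicAlgCl p)),
      O = (Valued.v : Valuation (PadicAlgCl p) NNReal).valuationSubring →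
      ∀ (ρ : FramedGaloisRep F (PadicAlgCl p) 2)
        (ρ₀ : absoluteGaloisGroup F →* Matrix.GeneralLinearGroup (Fin 2) O),
        Hyps p O ρ ρ₀ →
        ∃ (𝒰 : TameLevel 2 F p) (q : HeightOneSpectrum (𝓞 F))
          (A : Type) (_ : CommRing A) (_ : IsDomain A) (_ : IsLocalRing A) (_ : TopologicalSpace A)
          (_ : IsTopologicalRing A) (φ : O →+* A) (r : FramedGaloisRep F A 2),
          IsLocalHom φ ∧ Continuous φ ∧ ringKrullDim A = 1 ∧
          𝒰.IsPadicallyAutomorphic r ∧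
          (FramedRep.baseChangeRepresentation (algebraMap A (FractionRing A)) r).IsIrreducible ∧
          (∀ g, (r g).val 1 0 ∈ maximalIdeal A ∧
            (r g).val 0 0 - φ ((ρ₀ g).val 0 0) ∈ maximalIdeal A ∧
            (r g).val 1 1 - φ ((ρ₀ g).val 1 1) ∈ maximalIdeal A) ∧
          (∀ v : HeightOneSpectrum (𝓞 F), (p : 𝓞 F) ∈ v.asIdeal →
            ∃ Q : Matrix.GeneralLinearGroup (Fin 2) A, IsUnit (Q.val 1 0) ∧
              (∀ σ, (Q⁻¹ * r.toLocal v σ * Q).val 1 0 = 0) ∧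
              ∀ m : ℕ, 0 < m → ∃ σ, σ ∈ absInertia (v.adicCompletion F) ∧
                (Q⁻¹ * r.toLocal v σ * Q).val 0 0 ^ m ≠ (Q⁻¹ * r.toLocal v σ * Q).val 1 1 ^ m) ∧
          ∀ v : HeightOneSpectrum (𝓞 F), v ≠ q → (p : 𝓞 F) ∉ v.asIdeal →
            ResiduallyUnramifiedAt O ρ₀ v → v ∉ 𝒰.bad

/-! ## §5 Attack log, pins, and why the crux resists (cycle 1)

ATTACKS RUN (all cheap; none bites):
* Elaboration: rc 0 (`W.lean`: `unfold; intro …`); statement read back symbol by symbol — no junk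
  operator (`k - 1` with `k ≥ 2`; `Valued.v` on `ℚ̄_p`; `O` pinned to the valuation ring, so `𝔪`
  is the genuine maximal ideal and `κ = 𝔽̄_p`; `primesAbove`/`Ideal.inertia`/`absInertia`/
  `IsArithFrobAt` genuine; `TameLevel.mem_bad_of_mem` forces `{v ∣ p} ⊆ bad`, consistent with the
  level clause which only constrains `v ∤ p`).
* Triviality (`simp`/`aesop` on the whole statement): heartbeat exhaustion, no progress (the
  conclusion asks for an inhabitant of `IsPadicallyAutomorphic` at an IRREDUCIBLE `r`).
* Vacuity: the hypothesis package is satisfiable on paper (`T₅(11a1)|_{Γ_{ℚ(√-2)}}` on the lattice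
  `T₅E`, `k = 2`, `m = 1`; 2026-08-15 refuter note) but NO admissible `(ρ, ρ₀)` is constructible in
  Mathlib + tree today (needs a continuous irreducible `Γ_F → GL₂(ℚ̄_p)` ordinary of weight ≥ 2:
  Tate modules of elliptic curves over number fields as Galois representations, or Galois
  representations of cusp forms — absent).  `orientation_ne_zero`: the orientation inequality is
  not junk-satisfiable.
* Junk models of the conclusion: `IsPadicallyAutomorphic` needs a continuous ring map
  `𝕋(𝒰) → ℚ̄_p`; the only points of `𝕋(𝒰)` one could hope to write down (degree characters on
  `H⁰(X_U, ℤ/p^s)`, i.e. `T_{v,1} ↦ q_v + 1`, `T_{v,2} ↦ 1`) are associated with `1 ⊕ ε`, which is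
  REDUCIBLE — excluded by `r.toGaloisRep.IsIrreducible`. No junk inhabitant; no junk obstruction.
* Degenerate parameters: `p = 3` allowed (`p ≠ 2` only) incl. `F = ℚ(√-3) ∋ ζ₃` (ω|Γ_F = 1;
  distinguishedness then comes from `χ̄_aχ̄_b⁻¹` alone) — intended proof has no Hida theory there,
  truth unaffected as far as anyone knows; `q` may be taken above `p` (then the seed is the
  minimal-level statement `SeedMinimal`, believed false in the unit-`L`-value regime — so the
  freedom to choose `q ∤ p` is used essentially).
* One auxiliary place vs base change: for `F = ℚ(√-p)`, `p ≡ 3 (4)`, a rational prime `ℓ ≡ 1 (p)`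
  always SPLITS in `F` ((-p/ℓ) = (ℓ/p) = 1), so Mazur-type level-`ℓ` Eisenstein congruences over `ℚ`
  base-change to level `𝔩𝔩̄` (TWO places).  Not an obstruction to truth: weight `k'` and nebentype
  are free in the conclusion (`ω^j|_{Γ_F}` depends on `j mod (p-1)/2` only; level-`ℓ` newforms with
  `ρ̄^ss = 1 ⊕ ω^{k'-1}` exist under congruence conditions of the shape `ℓ^{k'} ≡ 1` or
  `ℓ^{k'-2} ≡ 1 (mod p)` — Billerey–Menares 2016, quoted from memory, to be re-checked — and
  inert `ℓ` = non-residues mod `p` satisfy these for suitable `k'`), and genuine level-`𝔩` Bianchi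
  congruences are not excluded.  Recorded as the place where a counterexample search should look:
  GENUINE (non-base-change, non-CM) residual pairs over `F`, where Calegari–Mazur sparsity makes
  classical parallel-weight Eisenstein-congruent points rare.
* Residual Galois cohomology (paper): Greenberg–Wiles with the complex place contributing `-1`
  and `Σ_{v∣p}[F_v:ℚ_p] = 2` shows both Ribet leaves of the wanted `r` have room at level
  `cond · q` for ONE `q` split completely in `K_{dual}(ζ_p)` (Chebotarev); no parity obstruction
  over a totally complex field. No cheap kill of the one-`q` clause.
* Literature: SW99 (held, pp. 8, 18, 46–47, 63 read): step (II) = Prop. 4.2 + §3.4; §3.4 needs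
  `ord(L_p(F, -1, χω)) > 0` at MINIMAL level `cond(χω⁻¹)` and SW reach it by changing `F`
  (abelian base change, Washington), never by level raising; nice primes have CHARACTERISTIC `p`
  (§2.3).  Hence the crux is STRONGER than and DIFFERENT from SW (II) (briefing B2 of the
  2026-08-15 note, confirmed at page level): it asks for a characteristic-0, arithmetic
  parallel-weight, oriented-ordinary Eisenstein-congruent point at level `cond · q`.
  Berger 2009 (lower bound on the Eisenstein denominator by `L^alg(0,χ)`, split `p`, torsion-free
  `H²_c`) + Branchereau (upper bound, arXiv/thesis 2023–24) govern the MINIMAL level; nothing in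
  print raises the level at one `q` for Bianchi Eisenstein classes with a char-0 cuspidal output.

PINS — why `¬ EisensteinProModularSeed` cannot be landed this epoch: by `crux_iff_rebracketed`
a refutation must EXHIBIT `(F, p, ρ, ρ₀)` with `Hyps` and prove `¬ Concl`.  `Hyps` needs a genuine
continuous irreducible ordinary `ρ` (not constructible); `¬ Concl` needs the NON-EXISTENCE of an
irreducible pro-modular `r` of controlled level — a statement about all continuous `ℚ̄_p`-points of
the constructed big Hecke algebra of the Bianchi tower, for which the tree has no structure theorem
(no Eichler–Shimura/Franke comparison, no Galois representations attached to eigensystems, no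
Jacquet–Shalika).  Symmetrically `Concl` is not provable.  The crux is interface-level on both sides.

WHY IT RESISTS ON PAPER: for residual pairs descending to `ℚ` the conclusion is TRUE (base change of
Billerey–Menares/Mazur/Ribet Eisenstein-congruent newforms at one inert auxiliary prime, ordinary
since `a_p ≡ χ_a(p)` is a unit, orientation automatic by `p`-distinguishedness, Ribet lattice);
for genuine pairs it is OPEN and plausibly delicate (torsion congruences do not give `ℚ̄_p`-points;
classical parallel-weight points on Eisenstein components of the Bianchi eigenvariety are sparse),
but no instance is known or computable here where it fails.
-/


/-! ## §6 Gen 2, cycle 1 (2026-08-16): the level clause is the whole content; oriented frames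
read residually; what `Concl` pins on the eigensystem; Borel-shaped `r` never witness -/

section GenTwo

open scoped Matrix

variable {F : Type} [Field F] [NumberField F] {p : ℕ} [Fact p.Prime]
  {O : ValuationSubring (PadicAlgCl p)}

/-! ### §6.1 Dropping the level clause collapses the seed into the engine -/

/-- **`SeedNoLevel`** — the crux with its LEVEL CLAUSE deleted (no auxiliary place, no
hyperspeciality constraint on `𝒰.bad`): "every admissible `(ρ, ρ₀)` has an irreducible
oriented-ordinary `p`-adically automorphic partner with the same ordered residual pair, of SOME
tame level". -/
def SeedNoLevel : Prop :=
  ∀ (F : Type) [Field F] [NumberField F], IsTotallyComplex F → Module.finrank ℚ F = 2 →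
    ∀ (p : ℕ) [Fact p.Prime], p ≠ 2 → ∀ (O : ValuationSubring (PadicAlgCl p)),
      O = (Valued.v : Valuation (PadicAlgCl p) NNReal).valuationSubring →
      ∀ (ρ : FramedGaloisRep F (PadicAlgCl p) 2)
        (ρ₀ : absoluteGaloisGroup F →* Matrix.GeneralLinearGroup (Fin 2) O),
        Hyps p O ρ ρ₀ →
        ∃ (𝒰 : TameLevel 2 F p) (r : FramedGaloisRep F (PadicAlgCl p) 2)
          (r₀ : absoluteGaloisGroup F →* Matrix.GeneralLinearGroup (Fin 2) O),
          r.toGaloisRep.IsIrreducible ∧ 𝒰.IsPadicallyAutomorphic r ∧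
            r.HasUpperTriangularIntegralModel r₀ ∧ DiagCongr O r₀ ρ₀ ∧ OrientedOrdinary p r

/-- The crux implies its level-free weakening (forget `q` and the clause). [folklore] -/
theorem seedNoLevel_of_crux (h : EisensteinProModularSeed) : SeedNoLevel := by
  rw [crux_iff_rebracketed] at h
  intro F _ _ hF hdeg p _ hp O hO ρ ρ₀ hh
  obtain ⟨𝒰, r, r₀, -, hirr, hpa, hmod, hdiag, hord, -⟩ := h F hF hdeg p hp O hO ρ ρ₀ hh
  exact ⟨𝒰, r, r₀, hirr, hpa, hmod, hdiag, hord⟩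

/-- **The level clause is the whole content of the seed relative to the engine.** The ENGINE
`ReducibleOrdinaryProModular` (rank-2 crux of the same route) already implies `SeedNoLevel`,
with the tautological partner `r := ρ`, `r₀ := ρ₀`: every hypothesis the seed's conclusion asks of
`r` except the level clause is among the hypotheses on `ρ`.  So (i) a proof of the seed that does
not USE the level clause's freedom is a proof of (a case of) the engine, and (ii) any refutation of
the seed must go through the level clause — it must be a residual pair whose EVERY irreducible
oriented-ordinary pro-modular realisation has tame conductor supported on at least two places off
`p · cond(χ̄_a) cond(χ̄_b)`. [folklore] -/
theorem seedNoLevel_of_engine (h : ReducibleOrdinaryProModular) : SeedNoLevel := by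
  intro F _ _ hF hdeg p _ hp O hO ρ ρ₀ hh
  obtain ⟨hirr, hunr, hmod, k, hk, m, hm, hloc⟩ := hh
  obtain ⟨𝒰, h𝒰⟩ := h F hF hdeg p hp O hO ρ ρ₀ hirr hunr hmod ⟨k, hk, m, hm, hloc⟩
  exact ⟨𝒰, ρ, ρ₀, hirr, h𝒰, hmod, DiagCongr.refl ρ₀, k, hk, m, hm, fun v hv => (hloc v hv).2⟩

/-- If the auxiliary place `q` of `Concl` happens to lie ABOVE `p`, the level clause is the
minimal-level clause of `SeedMinimal` (every `v ∤ p` off the residual conductor is hyperspecial):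
the `∃ q` is a genuine weakening only for `q ∤ p`. [folklore] -/
theorem levelClause_minimal_of_above_p {𝒰 : TameLevel 2 F p}
    {ρ₀ : absoluteGaloisGroup F →* Matrix.GeneralLinearGroup (Fin 2) O}
    {q : HeightOneSpectrum (𝓞 F)} (hq : (p : 𝓞 F) ∈ q.asIdeal)
    (h : ∀ v : HeightOneSpectrum (𝓞 F), v ≠ q → (p : 𝓞 F) ∉ v.asIdeal →
      ResiduallyUnramifiedAt O ρ₀ v → v ∉ 𝒰.bad) :
    ∀ v : HeightOneSpectrum (𝓞 F), (p : 𝓞 F) ∉ v.asIdeal →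
      ResiduallyUnramifiedAt O ρ₀ v → v ∉ 𝒰.bad :=
  fun v hvp hur => h v (fun hvq => hvp (hvq ▸ hq)) hvp hur

/-! ### §6.2 Borel-shaped representations never witness `Concl` -/

omit [NumberField F] in
/-- A rank-two framed representation over a field with a `G`-STABLE LINE is reducible
(Mathlib `Representation.IsIrreducible` = the subrepresentation lattice is simple; the line is a
subrepresentation strictly between `⊥` and `⊤`). [folklore] -/
theorem _root_.Literature.NumberTheory.GaloisRepresentations.FramedRep.not_isIrreducible_of_stableLine
    {G : Type*} [Group G] [TopologicalSpace G] {A : Type*} [Field A] [TopologicalSpace A]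
    (r : FramedRep G A 2) (w : Fin 2 → A) (hw : w ≠ 0)
    (hst : ∀ g, ∃ c : A, ((r g : GL (Fin 2) A) : Matrix (Fin 2) (Fin 2) A) *ᵥ w = c • w) :
    ¬ r.IsIrreducible := by
  intro hirr
  let L : Subrepresentation r.toRepresentation :=
    { toSubmodule := Submodule.span A {w}
      apply_mem_toSubmodule := fun g v hv => by
        obtain ⟨a, rfl⟩ := Submodule.mem_span_singleton.mp hv
        obtain ⟨c, hc⟩ := hst g
        rw [FramedRep.toRepresentation_apply_apply, Matrix.mulVec_smul, hc, smul_smul]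
        exact Submodule.mem_span_singleton.mpr ⟨a * c, rfl⟩ }
  have hmem : ∀ x, x ∈ L ↔ x ∈ Submodule.span A {w} := fun x => Iff.rfl
  haveI : IsSimpleOrder (Subrepresentation r.toRepresentation) := hirr
  rcases IsSimpleOrder.eq_bot_or_eq_top L with hb | ht
  · have hwL : w ∈ L := (hmem w).mpr (Submodule.mem_span_singleton_self w)
    rw [hb] at hwL
    change w ∈ ((⊥ : Subrepresentation r.toRepresentation).toSubmodule) at hwL
    change w ∈ (⊥ : Submodule A (Fin 2 → A)) at hwL
    exact hw ((Submodule.mem_bot A).mp hwL)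
  · -- some coordinate of `w` is non-zero; the OTHER basis vector is not on the line
    obtain ⟨i, hi⟩ : ∃ i, w i ≠ 0 := by
      by_contra hall
      push Not at hall
      exact hw (funext hall)
    have hne : ∀ i : Fin 2, i + 1 ≠ i := by decide
    obtain ⟨j, hj⟩ : ∃ j : Fin 2, j ≠ i := ⟨i + 1, hne i⟩
    have hjL : (Pi.single j 1 : Fin 2 → A) ∈ L := by
      rw [ht]
      change (Pi.single j 1 : Fin 2 → A) ∈ ((⊤ : Subrepresentation r.toRepresentation).toSubmodule)
      change (Pi.single j 1 : Fin 2 → A) ∈ (⊤ : Submodule A (Fin 2 → A))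
      exact Submodule.mem_top
    obtain ⟨c, hc⟩ := Submodule.mem_span_singleton.mp ((hmem _).mp hjL)
    have h1 : c * w i = 0 := by
      have := congrFun hc i
      rwa [Pi.smul_apply, smul_eq_mul, Pi.single_eq_of_ne hj.symm] at this
    have h2 : c * w j = 1 := by
      have := congrFun hc j
      rwa [Pi.smul_apply, smul_eq_mul, Pi.single_eq_same] at this
    rcases mul_eq_zero.mp h1 with hc0 | hwi
    · rw [hc0, zero_mul] at h2; exact zero_ne_one h2
    · exact hi hwi

omit [NumberField F] in
/-- The first column of an invertible `2 × 2` matrix is non-zero. [folklore] -/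
theorem col_zero_ne_zero {A : Type*} [Field A] (P : GL (Fin 2) A) :
    (fun i => (P : Matrix (Fin 2) (Fin 2) A) i 0) ≠ 0 := by
  intro h
  have h0 : (P : Matrix (Fin 2) (Fin 2) A) 0 0 = 0 := congrFun h 0
  have h1 : (P : Matrix (Fin 2) (Fin 2) A) 1 0 = 0 := congrFun h 1
  have hdet : (P : Matrix (Fin 2) (Fin 2) A).det = 0 := by
    rw [Matrix.det_fin_two, h0, h1]; ring
  exact (Matrix.GeneralLinearGroup.det P).ne_zero
    (by rw [Matrix.GeneralLinearGroup.val_det_apply]; exact hdet)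

omit [NumberField F] in
/-- If in some frame `P` the conjugate `P⁻¹ r P` is UPPER TRIANGULAR ON ALL OF `G` (a global
Borel shape: `χ₁ ⊕ χ₂`, `1 ⊕ ε`, any Kummer-type extension `(χ₁ ∗; 0 χ₂)`), then the line spanned
by the first column of `P` is `G`-stable, so `r` is REDUCIBLE.  Hence no globally Borel-shaped `r`
— in particular no representation associated with an Eisenstein / degree-character point of the
big Hecke algebra — can witness `Concl` (which demands `r.toGaloisRep.IsIrreducible`); and the
hypothesis `ρ.toGaloisRep.IsIrreducible` excludes every `ρ` one can presently construct in the
tree (sums and extensions of characters). [folklore] -/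
theorem _root_.Literature.NumberTheory.GaloisRepresentations.FramedRep.not_isIrreducible_of_conj_upperTriangular
    {G : Type*} [Group G] [TopologicalSpace G] {A : Type*} [Field A] [TopologicalSpace A]
    (r : FramedRep G A 2) (P : GL (Fin 2) A) (h : ∀ g, (P⁻¹ * r g * P).val 1 0 = 0) :
    ¬ r.IsIrreducible := by
  refine r.not_isIrreducible_of_stableLine (fun i => (P : Matrix (Fin 2) (Fin 2) A) i 0)
    (col_zero_ne_zero P) fun g => ⟨(P⁻¹ * r g * P).val 0 0, ?_⟩
  set B := P⁻¹ * r g * P with hBdef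
  have hg : (B : Matrix (Fin 2) (Fin 2) A) 1 0 = 0 := h g
  have e : r g * P = P * B := by rw [hBdef]; group
  funext i
  have hi := congrArg (fun M : GL (Fin 2) A => (M : Matrix (Fin 2) (Fin 2) A) i 0) e
  simp only [Units.val_mul, Matrix.mul_apply, Fin.sum_univ_two] at hi
  simp only [Matrix.mulVec, dotProduct, Fin.sum_univ_two, Pi.smul_apply, smul_eq_mul]
  rw [hi, hg, mul_zero, add_zero, mul_comm]

/-- Crux-level corollary: the `r` of `Concl` is upper triangular in NO frame. [folklore] -/
theorem concl_witness_not_borel {ρ₀ : absoluteGaloisGroup F →* Matrix.GeneralLinearGroup (Fin 2) O}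
    (h : Concl p O ρ₀) :
    ∃ (𝒰 : TameLevel 2 F p) (r : FramedGaloisRep F (PadicAlgCl p) 2),
      𝒰.IsPadicallyAutomorphic r ∧
        ∀ P : Matrix.GeneralLinearGroup (Fin 2) (PadicAlgCl p), ∃ g, (P⁻¹ * r g * P).val 1 0 ≠ 0 := by
  obtain ⟨𝒰, r, r₀, q, hirr, hpa, -⟩ := h
  refine ⟨𝒰, r, hpa, fun P => ?_⟩
  by_contra hall
  push Not at hall
  exact FramedRep.not_isIrreducible_of_conj_upperTriangular r P hall hirr

/-! ### §6.3 Reading an ORIENTED ordinary frame residually: `θ̄₁ = χ̄_b`, `θ̄₂ = χ̄_a` -/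

omit [NumberField F] in
/-- Entries of a framed representation with an integral model in the same frame are the images
of the model's entries. [folklore] -/
theorem entry_eq_of_integralModel {G : Type*} [Group G] [TopologicalSpace G] {n : ℕ}
    {r : FramedRep G (PadicAlgCl p) n} {r₀ : G →* GL (Fin n) O}
    (h : FramedRep.HasUpperTriangularIntegralModel r r₀) (g : G) (i j : Fin n) :
    (r g).val i j = ((r₀ g).val i j : PadicAlgCl p) := by
  rw [← h.1 g]; rfl

/-- **What the orientation inequality says residually.** Let `r₀` be a residually
upper-triangular integral model of `r` in the frame `(e₀, e₁)` (so `(r₀)₀₀ mod 𝔪 = χ̄_a` is the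
character of the residual sub-line `⟨ē₀⟩` and `(r₀)₁₁ mod 𝔪 = χ̄_b` that of the quotient), and let
`Q` be an ORIENTED frame at `σ` (`‖Q₀₀‖ ≤ ‖Q₁₀‖`, `(Q⁻¹ r(σ) Q)₁₀ = 0`).  Then the diagonal entries
`θ₁(σ) = (Q⁻¹ r(σ) Q)₀₀` (the character of the stable line `Q e₀` — in the crux the ORDINARY
SUB, `θ₁^m = ε^{(k-1)m}` on inertia) and `θ₂(σ) = (Q⁻¹ r(σ) Q)₁₁` are INTEGRAL and
`θ₁(σ) ≡ (r₀ σ)₁₁`, `θ₂(σ) ≡ (r₀ σ)₀₀ (mod 𝔪)`: **the ordinary sub-character reduces to the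
residual QUOTIENT character `χ̄_b`, the ordinary quotient to the residual SUB `χ̄_a`**, at every
place where the clause is imposed.  (Proof: `Q e₀ ∼ (u, 1)` with `u = Q₀₀/Q₁₀ ∈ O` by the
inequality — this is where `O = 𝒪_{ℚ̄_p}` (the pinning `hO`) is used —, and
`r₀(σ)(u,1)ᵀ = (∗, c u + d)ᵀ` with `c ∈ 𝔪`; `θ₂` from the trace.)  This is the formal content of
"SW orientation" in both `Hyps` (for `ρ`) and `Concl` (for `r`): the seed demands the SAME
orientation `θ̄₁^{(v)} = χ̄_b|_{D_v}` at EVERY `v ∣ p` ("parallel orientation"); see §6.5 for why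
this excludes the Eisenstein congruences in print over imaginary quadratic fields. [folklore] -/
theorem orientedFrame_diag_congr (hO : O = (Valued.v : Valuation (PadicAlgCl p) NNReal).valuationSubring)
    {G : Type*} [Group G] [TopologicalSpace G]
    {r : FramedRep G (PadicAlgCl p) 2} {r₀ : G →* GL (Fin 2) O}
    (hmod : FramedRep.HasUpperTriangularIntegralModel r r₀)
    (Q : Matrix.GeneralLinearGroup (Fin 2) (PadicAlgCl p))
    (hQ : Valued.v (Q.val 0 0) ≤ Valued.v (Q.val 1 0)) (σ : G)
    (hB : (Q⁻¹ * r σ * Q).val 1 0 = 0) :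
    ∃ t₁ t₂ : O, (t₁ : PadicAlgCl p) = (Q⁻¹ * r σ * Q).val 0 0 ∧
      (t₂ : PadicAlgCl p) = (Q⁻¹ * r σ * Q).val 1 1 ∧
      t₁ - (r₀ σ).val 1 1 ∈ maximalIdeal O ∧ t₂ - (r₀ σ).val 0 0 ∈ maximalIdeal O := by
  have hQ10 : Q.val 1 0 ≠ 0 := orientation_ne_zero Q hQ
  -- the integral parameter `u = Q₀₀ / Q₁₀` of the line `Q e₀` (here `hO` is used)
  have hu : Q.val 0 0 / Q.val 1 0 ∈ O := by
    rw [hO, Valuation.mem_valuationSubring_iff, map_div₀]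
    exact div_le_one_of_le₀ hQ zero_le
  set u : O := ⟨Q.val 0 0 / Q.val 1 0, hu⟩ with hu_def
  have hu' : Q.val 0 0 / Q.val 1 0 * Q.val 1 0 = Q.val 0 0 := div_mul_cancel₀ _ hQ10
  have hc : (r₀ σ).val 1 0 ∈ maximalIdeal O :=
    ((isResiduallyUpperTriangular_two_iff r₀).mp hmod.2) σ
  set B := Q⁻¹ * r σ * Q with hBdef
  have hB10 : (B : Matrix (Fin 2) (Fin 2) (PadicAlgCl p)) 1 0 = 0 := hB
  -- `r(σ) Q = Q B`, entry `(1,0)`: `c Q₀₀ + d Q₁₀ = Q₁₀ B₀₀`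
  have e : r σ * Q = Q * B := by rw [hBdef]; group
  have h10 := congrArg (fun M : GL (Fin 2) (PadicAlgCl p) => (M : Matrix (Fin 2) (Fin 2) (PadicAlgCl p)) 1 0) e
  simp only [Units.val_mul, Matrix.mul_apply, Fin.sum_univ_two] at h10
  rw [hB10, mul_zero, add_zero, entry_eq_of_integralModel hmod σ 1 0,
    entry_eq_of_integralModel hmod σ 1 1] at h10
  -- solve for `B₀₀ = c u + d`
  have hB00 : (B : Matrix (Fin 2) (Fin 2) (PadicAlgCl p)) 0 0 =
      ((r₀ σ).val 1 0 : PadicAlgCl p) * (Q.val 0 0 / Q.val 1 0) +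
        ((r₀ σ).val 1 1 : PadicAlgCl p) := by
    apply mul_right_cancel₀ hQ10
    linear_combination -h10 - ((r₀ σ).val 1 0 : PadicAlgCl p) * hu'
  -- the trace gives `B₁₁ = a - c u`
  have hBval : (B : Matrix (Fin 2) (Fin 2) (PadicAlgCl p)) =
      ((Q⁻¹ : GL (Fin 2) (PadicAlgCl p)) : Matrix (Fin 2) (Fin 2) (PadicAlgCl p)) * (r σ).val *
        (Q : Matrix (Fin 2) (Fin 2) (PadicAlgCl p)) := by
    rw [hBdef, Units.val_mul, Units.val_mul]
  have htr : (B : Matrix (Fin 2) (Fin 2) (PadicAlgCl p)) 0 0 +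
      (B : Matrix (Fin 2) (Fin 2) (PadicAlgCl p)) 1 1 =
      ((r₀ σ).val 0 0 : PadicAlgCl p) + ((r₀ σ).val 1 1 : PadicAlgCl p) := by
    have t := Matrix.trace_units_conj' Q (r σ).val
    rw [Matrix.trace_fin_two, Matrix.trace_fin_two, entry_eq_of_integralModel hmod σ 0 0,
      entry_eq_of_integralModel hmod σ 1 1] at t
    rw [hBval]
    exact t
  have hB11 : (B : Matrix (Fin 2) (Fin 2) (PadicAlgCl p)) 1 1 =
      ((r₀ σ).val 0 0 : PadicAlgCl p) -
        ((r₀ σ).val 1 0 : PadicAlgCl p) * (Q.val 0 0 / Q.val 1 0) := by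
    linear_combination htr - hB00
  refine ⟨(r₀ σ).val 1 0 * u + (r₀ σ).val 1 1, (r₀ σ).val 0 0 - (r₀ σ).val 1 0 * u, ?_, ?_, ?_, ?_⟩
  · rw [hB00]; push_cast; rw [hu_def]
  · rw [hB11]; push_cast; rw [hu_def]
  · rw [add_sub_cancel_right]; exact Ideal.mul_mem_right _ _ hc
  · rw [sub_sub_cancel_left]; exact (maximalIdeal O).neg_mem (Ideal.mul_mem_right _ _ hc)

/-- Crux-level reading of the orientation, for the conclusion: at every `v ∣ p` and every
`σ ∈ Γ_{F_v}`, the ordinary sub-character `θ₁` of the partner `r` is integral and reduces to the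
residual QUOTIENT character of `ρ₀` (`(ρ₀)₁₁ mod 𝔪 = χ̄_b`), and `θ₂` to the residual SUB `χ̄_a`
(`DiagCongr` transports from `r₀` to `ρ₀`). Same statement for `ρ` itself under `Hyps`. [folklore] -/
theorem concl_orientation_residual
    (hO : O = (Valued.v : Valuation (PadicAlgCl p) NNReal).valuationSubring)
    {r : FramedGaloisRep F (PadicAlgCl p) 2}
    {r₀ ρ₀ : absoluteGaloisGroup F →* Matrix.GeneralLinearGroup (Fin 2) O}
    (hmod : r.HasUpperTriangularIntegralModel r₀) (hdiag : DiagCongr O r₀ ρ₀)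
    {v : HeightOneSpectrum (𝓞 F)} {k m : ℕ} (hord : OrientedOrdinaryAt p r v k m) :
    ∃ Q : Matrix.GeneralLinearGroup (Fin 2) (PadicAlgCl p),
      (∀ σ, (Q⁻¹ * r.toLocal v σ * Q).val 1 0 = 0) ∧
      ∀ σ, ∃ t₁ t₂ : O, (t₁ : PadicAlgCl p) = (Q⁻¹ * r.toLocal v σ * Q).val 0 0 ∧
        (t₂ : PadicAlgCl p) = (Q⁻¹ * r.toLocal v σ * Q).val 1 1 ∧
        t₁ - (ρ₀ (absGaloisRestrict F (v.adicCompletion F) σ)).val 1 1 ∈ maximalIdeal O ∧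
        t₂ - (ρ₀ (absGaloisRestrict F (v.adicCompletion F) σ)).val 0 0 ∈ maximalIdeal O := by
  obtain ⟨Q, hQ, hQσ⟩ := hord
  refine ⟨Q, fun σ => (hQσ σ).1, fun σ => ?_⟩
  obtain ⟨t₁, t₂, h₁, h₂, h₁', h₂'⟩ := orientedFrame_diag_congr hO hmod Q hQ
    (absGaloisRestrict F (v.adicCompletion F) σ) (by simpa using (hQσ σ).1)
  refine ⟨t₁, t₂, by simpa using h₁, by simpa using h₂, ?_, ?_⟩
  · have := Ideal.add_mem _ h₁' (hdiag (absGaloisRestrict F (v.adicCompletion F) σ)).2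
    convert this using 1; ring
  · have := Ideal.add_mem _ h₂' (hdiag (absGaloisRestrict F (v.adicCompletion F) σ)).1
    convert this using 1; ring

/-! ### §6.3b Inertial types: what `(k, m)` force on the residual pair at `v ∣ p` -/

omit [NumberField F] in
/-- Congruence mod `𝔪` passes to powers. [folklore] -/
theorem pow_sub_pow_mem_maximalIdeal {a b : O} (h : a - b ∈ maximalIdeal O) (n : ℕ) :
    a ^ n - b ^ n ∈ maximalIdeal O := by
  rw [sub_mem_maximalIdeal_iff] at h ⊢
  rw [map_pow, map_pow, h]

/-- **Inertial type of an oriented-ordinary datum.** If `r₀` is a residually upper-triangular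
integral model of `r` (`O = 𝒪_{ℚ̄_p}`) and `r` is oriented-ordinary at `v` with weight `k` and exponent
`m`, then for every `σ` in the inertia group of `F_v`:
`(r₀ σ)₀₀ ^ m ≡ 1 (mod 𝔪)` — the residual SUB character `χ̄_a` has order dividing `m` on `I_v`, in
particular is UNRAMIFIED at `v` when `m = 1` — and `(r₀ σ)₁₁ ≡ t₁` with `t₁ ^ m = ε(σ)^{(k-1)m}` —
`χ̄_b|_{I_v} = ω^{k-1} ·` (a character of order dividing `m`).  Holds for `ρ` under `Hyps` and for
the partner `r` under `Concl` (`concl_inertial_type`).  This is the formal backbone of §7 C: a witness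
with `m' = 1` (crystalline-ordinary, "level prime to `p`") exists only for pairs of PARALLEL residual
inertial type (`χ̄_a` unramified and `χ̄_b = ω^{k'-1}` on `I_v` at EVERY `v ∣ p`); Berger-type pairs,
of inertial types `(1, ω)` at `𝔭` and `(ω, 1)` at `𝔭̄`, are parallel for NEITHER ordering. [folklore] -/
theorem orientedOrdinaryAt_inertial_type
    (hO : O = (Valued.v : Valuation (PadicAlgCl p) NNReal).valuationSubring)
    {r : FramedGaloisRep F (PadicAlgCl p) 2}
    {r₀ : absoluteGaloisGroup F →* Matrix.GeneralLinearGroup (Fin 2) O}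
    (hmod : r.HasUpperTriangularIntegralModel r₀) {v : HeightOneSpectrum (𝓞 F)} {k m : ℕ}
    (hord : OrientedOrdinaryAt p r v k m) :
    ∀ σ ∈ absInertia (v.adicCompletion F),
      (r₀ (absGaloisRestrict F (v.adicCompletion F) σ)).val 0 0 ^ m - 1 ∈ maximalIdeal O ∧
      ∃ t₁ : O, t₁ - (r₀ (absGaloisRestrict F (v.adicCompletion F) σ)).val 1 1 ∈ maximalIdeal O ∧
        (t₁ : PadicAlgCl p) ^ m =
          algebraMap (Padic p) (PadicAlgCl p)
            (((GaloisRep.cyclotomicCharacter (v.adicCompletion F) p σ).val : PadicInt p) :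
              Padic p) ^ ((k - 1) * m) := by
  intro σ hσ
  obtain ⟨Q, hQ, hQσ⟩ := hord
  obtain ⟨hB, hin⟩ := hQσ σ
  obtain ⟨h11, h00⟩ := hin hσ
  obtain ⟨t₁, t₂, ht₁, ht₂, ht₁', ht₂'⟩ := orientedFrame_diag_congr hO hmod Q hQ
    (absGaloisRestrict F (v.adicCompletion F) σ) hB
  refine ⟨?_, t₁, ht₁', by rw [ht₁]; exact h00⟩
  -- `t₂ ^ m = 1` in `O`, and `(r₀ σ)₀₀ ≡ t₂`
  have ht₂m : t₂ ^ m = 1 := by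
    apply Subtype.coe_injective
    push_cast
    rw [ht₂]
    exact h11
  have h' := pow_sub_pow_mem_maximalIdeal (sub_mem_comm_iff.mp ht₂') m
  rw [ht₂m] at h'
  exact h'

/-- `Concl` version: the residual pair of the GIVEN datum `ρ₀` has, for the partner's `(k', m')`,
`χ_a(σ)^{m'} ≡ 1` and `χ_b(σ) ≡ t₁`, `t₁^{m'} = ε(σ)^{(k'-1)m'}` for all inertia `σ` at every `v ∣ p`
(transport along `DiagCongr`). [folklore] -/
theorem concl_inertial_type (hO : O = (Valued.v : Valuation (PadicAlgCl p) NNReal).valuationSubring)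
    {ρ₀ : absoluteGaloisGroup F →* Matrix.GeneralLinearGroup (Fin 2) O} (h : Concl p O ρ₀) :
    ∃ k' : ℕ, 2 ≤ k' ∧ ∃ m' : ℕ, 0 < m' ∧ ∀ v : HeightOneSpectrum (𝓞 F), (p : 𝓞 F) ∈ v.asIdeal →
      ∀ σ ∈ absInertia (v.adicCompletion F),
        (ρ₀ (absGaloisRestrict F (v.adicCompletion F) σ)).val 0 0 ^ m' - 1 ∈ maximalIdeal O ∧
        ∃ t₁ : O, t₁ - (ρ₀ (absGaloisRestrict F (v.adicCompletion F) σ)).val 1 1 ∈ maximalIdeal O ∧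
          (t₁ : PadicAlgCl p) ^ m' =
            algebraMap (Padic p) (PadicAlgCl p)
              (((GaloisRep.cyclotomicCharacter (v.adicCompletion F) p σ).val : PadicInt p) :
                Padic p) ^ ((k' - 1) * m') := by
  obtain ⟨𝒰, r, r₀, q, -, -, hmod, hdiag, ⟨k', hk', m', hm', hord⟩, -⟩ := h
  refine ⟨k', hk', m', hm', fun v hv σ hσ => ?_⟩
  obtain ⟨h0, t₁, ht₁, ht₁m⟩ := orientedOrdinaryAt_inertial_type hO hmod (hord v hv) σ hσ
  set g := absGaloisRestrict F (v.adicCompletion F) σ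
  refine ⟨?_, t₁, ?_, ht₁m⟩
  · -- `(ρ₀ g)₀₀ ^ m' ≡ (r₀ g)₀₀ ^ m' ≡ 1`
    have h1 := pow_sub_pow_mem_maximalIdeal ((hdiag g).1) m'
    have := Ideal.sub_mem _ h0 h1
    convert this using 1; ring
  · have := Ideal.add_mem _ ht₁ (hdiag g).2
    convert this using 1; ring

/-! ### §6.3c The converse: unit root `≡ χ̄_a` at one distinguished element ⇒ oriented -/

omit [NumberField F] in
/-- In `O = 𝒪_{ℚ̄_p}`, an element of valuation `< 1` lies in the maximal ideal (a unit of `O` has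
valuation `1`). [folklore] -/
theorem mem_maximalIdeal_of_v_lt_one
    (hO : O = (Valued.v : Valuation (PadicAlgCl p) NNReal).valuationSubring) {x : O}
    (hx : Valued.v (x : PadicAlgCl p) < 1) : x ∈ maximalIdeal O := by
  subst hO
  rw [IsLocalRing.mem_maximalIdeal, mem_nonunits_iff]
  intro hu
  obtain ⟨y, hxy⟩ := hu.exists_right_inv
  have hy : Valued.v (y : PadicAlgCl p) ≤ 1 :=
    (Valuation.mem_valuationSubring_iff _ _).mp y.2
  have h1 : Valued.v (x : PadicAlgCl p) * Valued.v (y : PadicAlgCl p) = 1 := by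
    rw [← map_mul, ← map_one (Valued.v : Valuation (PadicAlgCl p) NNReal)]
    congr 1
    exact_mod_cast congrArg Subtype.val hxy
  have h2 : Valued.v (x : PadicAlgCl p) * Valued.v (y : PadicAlgCl p) < 1 :=
    mul_lt_one_of_nonneg_of_lt_one_left zero_le hx hy
  exact absurd h1 h2.ne

omit [NumberField F] in
/-- **Converse orientation lemma** (the ideators' `oriented_of_unitRoot_congr`, stub P1 of cards
`big-image-cousin` / `ell-switch-geometric-seed`, listed there as cheapest falsifier (a) — PROVED, so
the cards read the crux correctly).  Let `r₀` be a residually upper-triangular integral model of `r`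
(`O = 𝒪_{ℚ̄_p}`) and `Q` ANY frame with `(Q⁻¹ r(g) Q)₁₀ = 0` at ONE element `g` where the residual
diagonal is distinguished (`(r₀ g)₀₀ ≢ (r₀ g)₁₁`); if the lower-right ("unit-root", quotient) entry
`(Q⁻¹ r(g) Q)₁₁` is `≡ (r₀ g)₀₀ (mod 𝔪)`, then `Q` is ORIENTED: `‖Q₀₀‖ ≤ ‖Q₁₀‖`.  With
`orientedFrame_diag_congr`: for `p`-distinguished data the typed orientation clause ⟺ "ordinary in some
frame whose unit-root character is `≡ χ̄_a` at one distinguished `σ ∈ Γ_{F_v}`" ⟺ "… at every `σ`".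
Proof: an anti-oriented frame has its stable line reducing INTO `⟨ē₀⟩` (`u = Q₁₀/Q₀₀ ∈ 𝔪`), whence
`θ₁ = a + b u ≡ a`, `θ₂ = d - b u ≡ d`, and `θ₂ ≡ a` forces `a ≡ d`. [folklore] -/
theorem oriented_of_unitRoot_congr
    (hO : O = (Valued.v : Valuation (PadicAlgCl p) NNReal).valuationSubring)
    {G : Type*} [Group G] [TopologicalSpace G]
    {r : FramedRep G (PadicAlgCl p) 2} {r₀ : G →* GL (Fin 2) O}
    (hmod : FramedRep.HasUpperTriangularIntegralModel r r₀)
    (Q : Matrix.GeneralLinearGroup (Fin 2) (PadicAlgCl p)) (g : G)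
    (hB : (Q⁻¹ * r g * Q).val 1 0 = 0)
    (hunit : ∃ t : O, (t : PadicAlgCl p) = (Q⁻¹ * r g * Q).val 1 1 ∧ t - (r₀ g).val 0 0 ∈ maximalIdeal O)
    (hdist : (r₀ g).val 0 0 - (r₀ g).val 1 1 ∉ maximalIdeal O) :
    Valued.v (Q.val 0 0) ≤ Valued.v (Q.val 1 0) := by
  by_contra hlt
  push Not at hlt
  -- anti-oriented: `Q₀₀ ≠ 0`, `u = Q₁₀ / Q₀₀ ∈ 𝔪`
  have hQ00 : Q.val 0 0 ≠ 0 := by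
    intro h0; rw [h0, map_zero] at hlt; exact (not_lt_of_ge zero_le) hlt
  have hvu : Valued.v (Q.val 1 0 / Q.val 0 0) < 1 := by
    rw [map_div₀]; exact (div_lt_one ((Valuation.pos_iff _).mpr hQ00)).mpr hlt
  have hu : Q.val 1 0 / Q.val 0 0 ∈ O := by
    rw [hO, Valuation.mem_valuationSubring_iff]; exact hvu.le
  set u : O := ⟨Q.val 1 0 / Q.val 0 0, hu⟩ with hu_def
  have hum : u ∈ maximalIdeal O := mem_maximalIdeal_of_v_lt_one hO (by simpa [hu_def] using hvu)
  have hu' : Q.val 1 0 / Q.val 0 0 * Q.val 0 0 = Q.val 1 0 := div_mul_cancel₀ _ hQ00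
  set B := Q⁻¹ * r g * Q with hBdef
  have hB10 : (B : Matrix (Fin 2) (Fin 2) (PadicAlgCl p)) 1 0 = 0 := hB
  have e : r g * Q = Q * B := by rw [hBdef]; group
  -- row 0 of column 0: `a Q₀₀ + b Q₁₀ = Q₀₀ B₀₀`
  have h00 := congrArg (fun M : GL (Fin 2) (PadicAlgCl p) => (M : Matrix (Fin 2) (Fin 2) (PadicAlgCl p)) 0 0) e
  simp only [Units.val_mul, Matrix.mul_apply, Fin.sum_univ_two] at h00
  rw [hB10, mul_zero, add_zero, entry_eq_of_integralModel hmod g 0 0,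
    entry_eq_of_integralModel hmod g 0 1] at h00
  have hB00 : (B : Matrix (Fin 2) (Fin 2) (PadicAlgCl p)) 0 0 =
      ((r₀ g).val 0 0 : PadicAlgCl p) + ((r₀ g).val 0 1 : PadicAlgCl p) * (Q.val 1 0 / Q.val 0 0) := by
    apply mul_right_cancel₀ hQ00
    linear_combination -h00 - ((r₀ g).val 0 1 : PadicAlgCl p) * hu'
  -- trace: `B₁₁ = d - b u`
  have hBval : (B : Matrix (Fin 2) (Fin 2) (PadicAlgCl p)) =
      ((Q⁻¹ : GL (Fin 2) (PadicAlgCl p)) : Matrix (Fin 2) (Fin 2) (PadicAlgCl p)) * (r g).val *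
        (Q : Matrix (Fin 2) (Fin 2) (PadicAlgCl p)) := by
    rw [hBdef, Units.val_mul, Units.val_mul]
  have htr : (B : Matrix (Fin 2) (Fin 2) (PadicAlgCl p)) 0 0 +
      (B : Matrix (Fin 2) (Fin 2) (PadicAlgCl p)) 1 1 =
      ((r₀ g).val 0 0 : PadicAlgCl p) + ((r₀ g).val 1 1 : PadicAlgCl p) := by
    have t := Matrix.trace_units_conj' Q (r g).val
    rw [Matrix.trace_fin_two, Matrix.trace_fin_two, entry_eq_of_integralModel hmod g 0 0,
      entry_eq_of_integralModel hmod g 1 1] at t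
    rw [hBval]
    exact t
  have hB11 : (B : Matrix (Fin 2) (Fin 2) (PadicAlgCl p)) 1 1 =
      ((r₀ g).val 1 1 : PadicAlgCl p) - ((r₀ g).val 0 1 : PadicAlgCl p) * (Q.val 1 0 / Q.val 0 0) := by
    linear_combination htr - hB00
  -- the unit-root character is `≡ d`, and by hypothesis `≡ a`: contradiction with distinguishedness
  obtain ⟨t, ht, hta⟩ := hunit
  have htd : t = (r₀ g).val 1 1 - (r₀ g).val 0 1 * u := by
    apply Subtype.coe_injective
    push_cast
    rw [ht, hB11, hu_def]
  have htd' : t - (r₀ g).val 1 1 ∈ maximalIdeal O := by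
    rw [htd, sub_sub_cancel_left]
    exact (maximalIdeal O).neg_mem (Ideal.mul_mem_left _ _ hum)
  apply hdist
  have := Ideal.sub_mem _ htd' hta
  -- (t - d) - (t - a) = a - d
  convert this using 1; ring

/-- Crux-level corollary: an ordinary frame for `r.toLocal v` (the tree's `IsOrdinaryOfWeightAt`
shape, verbatim) whose unit-root entry is `≡ (r₀ σ₀)₀₀` at ONE residually distinguished `σ₀` IS an
oriented frame: `OrientedOrdinaryAt p r v k m`.  This is the exact interface the geometric-seed lines
need ("`U_v`-unit root `≡ χ̄_a(Frob)` + `p`-distinguished ⟹ the typed clause"). [folklore] -/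
theorem orientedOrdinaryAt_of_unitRoot_congr
    (hO : O = (Valued.v : Valuation (PadicAlgCl p) NNReal).valuationSubring)
    {r : FramedGaloisRep F (PadicAlgCl p) 2}
    {r₀ : absoluteGaloisGroup F →* Matrix.GeneralLinearGroup (Fin 2) O}
    (hmod : r.HasUpperTriangularIntegralModel r₀) {v : HeightOneSpectrum (𝓞 F)} {k m : ℕ}
    (Q : Matrix.GeneralLinearGroup (Fin 2) (PadicAlgCl p))
    (hQσ : ∀ σ, (Q⁻¹ * r.toLocal v σ * Q).val 1 0 = 0 ∧
      (σ ∈ absInertia (v.adicCompletion F) →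
        (Q⁻¹ * r.toLocal v σ * Q).val 1 1 ^ m = 1 ∧
        (Q⁻¹ * r.toLocal v σ * Q).val 0 0 ^ m =
          algebraMap (Padic p) (PadicAlgCl p)
            (((GaloisRep.cyclotomicCharacter (v.adicCompletion F) p σ).val : PadicInt p) :
              Padic p) ^ ((k - 1) * m)))
    (σ₀ : absoluteGaloisGroup (v.adicCompletion F))
    (hunit : ∃ t : O, (t : PadicAlgCl p) = (Q⁻¹ * r.toLocal v σ₀ * Q).val 1 1 ∧
      t - (r₀ (absGaloisRestrict F (v.adicCompletion F) σ₀)).val 0 0 ∈ maximalIdeal O)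
    (hdist : (r₀ (absGaloisRestrict F (v.adicCompletion F) σ₀)).val 0 0 -
      (r₀ (absGaloisRestrict F (v.adicCompletion F) σ₀)).val 1 1 ∉ maximalIdeal O) :
    OrientedOrdinaryAt p r v k m :=
  ⟨Q, oriented_of_unitRoot_congr hO hmod Q (absGaloisRestrict F (v.adicCompletion F) σ₀)
    (hQσ σ₀).1 hunit hdist, hQσ⟩

/-! ### §6.4 What `Concl` pins on the eigensystem: the Eisenstein congruence, typed -/

omit [NumberField F] [Fact p.Prime] in
open Polynomial in
/-- The rank-two Hecke–Frobenius polynomial of the big Hecke algebra file: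
`P_v = X² − a₁ X + q a₂`. [folklore] -/
theorem heckeFrobPoly_two_eq {A : Type*} [CommRing A] (q : ℕ) (a : ℕ → A) :
    BigHeckeGLn.heckeFrobPoly 2 q a = X ^ 2 - C (a 1) * X + C ((q : A) * a 2) := by
  rw [BigHeckeGLn.heckeFrobPoly, show Finset.Icc 1 2 = {1, 2} from rfl, Finset.sum_pair (by decide)]
  simp only [pow_one, map_mul, map_neg, map_one, map_pow, map_natCast]
  norm_num
  ring

omit [NumberField F] [Fact p.Prime] in
open Polynomial in
/-- Trace and determinant from `charpoly = P_v` in rank two. [folklore] -/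
theorem trace_det_of_charpoly_eq_heckeFrobPoly {A : Type*} [CommRing A] [Nontrivial A]
    (M : Matrix (Fin 2) (Fin 2) A) (q : ℕ) (a : ℕ → A)
    (h : M.charpoly = BigHeckeGLn.heckeFrobPoly 2 q a) :
    M.trace = a 1 ∧ M.det = (q : A) * a 2 := by
  rw [Matrix.charpoly_fin_two, heckeFrobPoly_two_eq] at h
  have h1 := congrArg (fun f : A[X] => f.coeff 1) h
  have h0 := congrArg (fun f : A[X] => f.coeff 0) h
  simp only [coeff_add, coeff_sub, coeff_X_pow, coeff_C_mul, coeff_X_one, coeff_C_zero,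
    coeff_X_zero, coeff_C_succ, mul_one, mul_zero] at h1 h0
  norm_num at h1 h0
  exact ⟨h1, h0⟩

/-- **Association pins trace and determinant of Frobenius.** If `x : 𝕋(𝒰) → ℚ̄_p` is associated
with `r`, then at every good place `v ∉ 𝒰.bad` and every arithmetic Frobenius `σ` at a prime
above `v`: `tr r(σ) = x(T_{v,1})` and `det r(σ) = q_v · x(T_{v,2})`.  For the seed's `r`
(oriented-ordinary of parallel weight `k'`, so `det r = ψ ε^{k'-1}` with `ψ` of finite order on
inertia) this says the central values `x(T_{v,2}) = ψ(Frob_v) q_v^{k'-2}` are ARITHMETIC of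
weight `k' - 2`: `x` is a parallel arithmetic-weight point of `𝕋(𝒰)`, not a general `p`-adic one.
[folklore] -/
theorem trace_det_frob_of_isAssociated {𝒰 : TameLevel 2 F p}
    {x : CompletedCohomologyHeckeAlgebraGLn 𝒰 →+* PadicAlgCl p}
    {r : FramedGaloisRep F (PadicAlgCl p) 2} (h : 𝒰.IsAssociated x r)
    {v : HeightOneSpectrum (𝓞 F)} (hv : v ∉ 𝒰.bad) {𝔓 : Ideal (absIntegers (𝓞 F) F)}
    (h𝔓 : 𝔓 ∈ v.primesAbove) {σ : absoluteGaloisGroup F} (hσ : IsArithFrobAt (𝓞 F) σ 𝔓) :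
    (r σ).val.trace = x (𝒰.heckeT v 1) ∧
      (r σ).val.det = (Ideal.absNorm v.asIdeal : PadicAlgCl p) * x (𝒰.heckeT v 2) :=
  trace_det_of_charpoly_eq_heckeFrobPoly _ _ _ ((h v hv).2 𝔓 h𝔓 σ hσ)

omit [NumberField F] in
/-- Trace and determinant of an integrally modelled `r` are the images of those of the model.
[folklore] -/
theorem trace_det_eq_of_integralModel {G : Type*} [Group G] [TopologicalSpace G]
    {r : FramedRep G (PadicAlgCl p) 2} {r₀ : G →* GL (Fin 2) O}
    (h : FramedRep.HasUpperTriangularIntegralModel r r₀) (g : G) :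
    (r g).val.trace = (((r₀ g).val 0 0 + (r₀ g).val 1 1 : O) : PadicAlgCl p) ∧
      (r g).val.det = (((r₀ g).val.det : O) : PadicAlgCl p) := by
  constructor
  · rw [Matrix.trace_fin_two, entry_eq_of_integralModel h g 0 0, entry_eq_of_integralModel h g 1 1]
    push_cast; rfl
  · rw [Matrix.det_fin_two, Matrix.det_fin_two, entry_eq_of_integralModel h g 0 0,
      entry_eq_of_integralModel h g 0 1, entry_eq_of_integralModel h g 1 0,
      entry_eq_of_integralModel h g 1 1]
    push_cast; rfl

omit [NumberField F] in
/-- For a residually upper-triangular model congruent on the diagonal to `ρ₀`: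
`tr ≡ (ρ₀)₀₀ + (ρ₀)₁₁` and `det ≡ (ρ₀)₀₀ (ρ₀)₁₁ (mod 𝔪)`. [folklore] -/
theorem trace_det_congr_of_diagCongr {G : Type*} [Group G]
    {r₀ ρ₀ : G →* GL (Fin 2) O} (hB : IsResiduallyUpperTriangular r₀)
    (hdiag : ∀ g, ((r₀ g).val 0 0 - (ρ₀ g).val 0 0 : O) ∈ maximalIdeal O ∧
      ((r₀ g).val 1 1 - (ρ₀ g).val 1 1 : O) ∈ maximalIdeal O) (g : G) :
    ((r₀ g).val 0 0 + (r₀ g).val 1 1) - ((ρ₀ g).val 0 0 + (ρ₀ g).val 1 1) ∈ maximalIdeal O ∧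
      (r₀ g).val.det - (ρ₀ g).val 0 0 * (ρ₀ g).val 1 1 ∈ maximalIdeal O := by
  obtain ⟨h0, h1⟩ := hdiag g
  have hc : (r₀ g).val 1 0 ∈ maximalIdeal O := ((isResiduallyUpperTriangular_two_iff r₀).mp hB) g
  constructor
  · have := Ideal.add_mem _ h0 h1
    convert this using 1; ring
  · rw [Matrix.det_fin_two]
    -- `a d - b c - a' d' = (a - a') d + a' (d - d') - b c`
    have := Ideal.sub_mem _ (Ideal.add_mem _ (Ideal.mul_mem_right ((r₀ g).val 1 1) _ h0)
      (Ideal.mul_mem_left _ ((ρ₀ g).val 0 0) h1)) (Ideal.mul_mem_left _ ((r₀ g).val 0 1) hc)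
    convert this using 1; ring

/-- **The Eisenstein congruence the seed actually asks for, extracted from `Concl`.** Any witness
of `Concl p O ρ₀` provides a tame level `𝒰` and a CONTINUOUS eigensystem `x : 𝕋(𝒰) → ℚ̄_p` such
that for every good place `v ∉ 𝒰.bad` and every arithmetic Frobenius `σ` above `v`,
`x(T_{v,1})` and `q_v x(T_{v,2})` are INTEGRAL (lie in `O = 𝒪_{ℚ̄_p}`) and
`x(T_{v,1}) ≡ χ_a(σ) + χ_b(σ)`, `q_v x(T_{v,2}) ≡ χ_a(σ) χ_b(σ) (mod 𝔪)`, where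
`χ_a = (ρ₀)₀₀`, `χ_b = (ρ₀)₁₁` are the diagonal entries of the GIVEN datum: `x` lies over the
EISENSTEIN maximal ideal `𝔪(χ̄_a, χ̄_b)` of `𝕋(𝒰)` (arithmetic-Frobenius normalisation), while
`r` is irreducible (cuspidal side).  Together with `concl_orientation_residual` (the `U_v`-side:
ordinary quotient `≡ χ̄_a` at every `v ∣ p`) this is the precise deliverable. [folklore] -/
theorem concl_eisenstein_congruence {ρ₀ : absoluteGaloisGroup F →* Matrix.GeneralLinearGroup (Fin 2) O}
    (h : Concl p O ρ₀) :
    ∃ (𝒰 : TameLevel 2 F p) (x : CompletedCohomologyHeckeAlgebraGLn 𝒰 →+* PadicAlgCl p),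
      Continuous x ∧
      ∀ v ∉ 𝒰.bad, ∀ 𝔓 ∈ v.primesAbove, ∀ σ : absoluteGaloisGroup F, IsArithFrobAt (𝓞 F) σ 𝔓 →
        ∃ t d : O, (t : PadicAlgCl p) = x (𝒰.heckeT v 1) ∧
          (d : PadicAlgCl p) = (Ideal.absNorm v.asIdeal : PadicAlgCl p) * x (𝒰.heckeT v 2) ∧
          t - ((ρ₀ σ).val 0 0 + (ρ₀ σ).val 1 1) ∈ maximalIdeal O ∧
          d - (ρ₀ σ).val 0 0 * (ρ₀ σ).val 1 1 ∈ maximalIdeal O := by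
  obtain ⟨𝒰, r, r₀, q, -, ⟨x, hxc, hx⟩, hmod, hdiag, -, -⟩ := h
  refine ⟨𝒰, x, hxc, fun v hv 𝔓 h𝔓 σ hσ => ?_⟩
  obtain ⟨htr, hdet⟩ := trace_det_frob_of_isAssociated hx hv h𝔓 hσ
  obtain ⟨htr₀, hdet₀⟩ := trace_det_eq_of_integralModel hmod σ
  obtain ⟨ctr, cdet⟩ := trace_det_congr_of_diagCongr hmod.2 hdiag σ
  exact ⟨(r₀ σ).val 0 0 + (r₀ σ).val 1 1, (r₀ σ).val.det, by rw [← htr₀, htr],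
    by rw [← hdet₀, hdet], ctr, cdet⟩

end GenTwo

/-! ## §7 Attack log, gen 2 cycle 1 (2026-08-16) — orientation dichotomy; Berger-type congruences are dead

READ FIRST: §5 (gen 1) stands unchanged — same pins (no admissible `(ρ, ρ₀)` constructible; `¬Concl`
is a non-existence theorem about `ℚ̄_p`-points of the constructed big Hecke algebra).  This cycle adds:

**A. The level clause is everything (`seedNoLevel_of_engine`).**  With the clause deleted the seed is
the engine at `r := ρ`.  Consequently the seed has independent content only as a LEVEL-OPTIMISATION
statement for Eisenstein congruences: "every admissible residual pair has an irreducible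
oriented-ordinary pro-modular realisation of tame conductor `cond(χ̄_a)cond(χ̄_b) · q^∞` for ONE `q`".
A counterexample is therefore a pair all of whose such realisations need ≥ 2 auxiliary places; a proof
that never chooses `q` cleverly proves the engine's conclusion for some `r` and nothing about level.

**B. Residual reading of the orientation (`orientedFrame_diag_congr`, `concl_orientation_residual`).**
In an oriented frame the ordinary sub-character `θ₁` (the one with `θ₁^m = ε^{(k-1)m}` on inertia) is
integral and `≡ χ_b`, and `θ₂ ≡ χ_a (mod 𝔪)` — at EVERY `v ∣ p`, for `ρ` (Hyps) and for `r` (Concl)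
alike.  So the seed asks for the UNIFORM ("parallel", Skinner–Wiles type-𝒟) orientation: unit-root /
finite-slope-zero character `≡ χ̄_a` at all places above `p`.  (The earlier refuter note read this off
SW99 Thm A on paper; it is now a lemma, and it uses `hO`.)

**C. Orientation dichotomy over an imaginary quadratic `F` (paper; Kostant/Harder).**  Boundary =
Eisenstein cohomology of the Bianchi group with coefficients of parallel weight `k'` decomposes by Weyl
elements `w ∈ W(Res_{F/ℚ} GL₂) = S₂ × S₂`: `ℓ(w) = 0, 2` (`w = 1, s_σ s_σ̄`) give pairs of Hecke
characters of PARALLEL infinity type (finite order × norm powers) — Galois side `χ_a ⊕ χ_b ε^{k'-1}`,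
`U_v`-ordinary at every `v ∣ p` with unit root `χ_a(Frob_v)`: exactly the typed orientation (B) —,
while `ℓ(w) = 1` (`w = s_σ, s_σ̄`) gives MIXED types, for `k' = 2` the characters of infinity type
`z^{±2}` / pairs `(φ₁, φ₂)` of types `(z, z⁻¹)`.  ALL Eisenstein-congruence theorems in print over
imaginary quadratic fields are of the mixed, degree-one kind: Berger, arXiv:math/0701177 = Compositio
145 (2009), p. 3 L52–58 and p. 8 L8–9 ("`φ₁, φ₂` … of infinity type `z` and `z⁻¹`"), Eisenstein ideal
generated by `T_v − φ₁(𝔓_v)Nm(𝔓_v) − φ₂(𝔓_v)` (p. 8 L31–35), Galois characters `ρ₁ = φ_{1,𝔭}ε`,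
`ρ₂ = φ_{2,𝔭}` with Hodge–Tate weights `0` and `1` AT `𝔭` (p. 9 L44–45); Berger 2008 (Manuscripta,
denominators), Berger–Klosin 2009/2011/2013 (`R = T` for the same residual pairs), Branchereau 2024
("An upper bound on the denominator of Eisenstein classes in Bianchi manifolds", p. 2: `χ` unramified of
infinity type `(-2, 0)`, degree-1 classes; exact denominator `= G₂(L_𝒪)` for `h = 1`, Cor. 4.6).
CONSEQUENCES for the typed seed: (i) split `p = 𝔭𝔭̄`: the congruent weight-2 cusp forms `π` are ordinary
at `𝔭` with unit root `a_𝔭(π) ≡ p·φ₁(𝔭) + φ₂(𝔭) ≢ 0` (loc. cit. p. 9 L43–47, Berger's statement); OUR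
reading of the valuations (`𝔭^h = (π)`: `φ₁(𝔭) ∼ π^{-1/h}`, `φ₂(𝔭) ∼ π^{1/h}` `𝔭`-adically, so the unit
is `pφ₁(𝔭)` and the HT-`0`-at-`𝔭` character is `ρ₁`, as Berger says on p. 9 L44–45) gives
`θ̄₂^{(𝔭)} = ρ̄₁|_{D_𝔭}`; at `𝔭̄` the valuations are exchanged and `θ̄₂^{(𝔭̄)} = ρ̄₂|_{D_𝔭̄}` — for level
prime to `p` this is FORCED by inertial types, independently of any valuation bookkeeping
(`ρ̄₂|_{I_𝔭} = ω`, `ρ̄₁|_{I_𝔭̄} = ω`, the unit-root character is unramified), so whichever global ordering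
`(χ̄_a, χ̄_b) ∈ {(ρ̄₁, ρ̄₂), (ρ̄₂, ρ̄₁)}` one takes, (B) fails at one of `𝔭, 𝔭̄` (given
`p`-distinguishedness, a hypothesis of the crux): MIXED orientation, the very configuration the route
header excludes ("mixed type at split 5 is outside Skinner–Wiles"); (ii) inert `p = 𝔭`: `Nm 𝔭 = p²`,
`a_𝔭(Eis) = p²φ₁(𝔭) + φ₂(𝔭)` has valuation `≥ 1` (OUR computation: `φ₁((p)) = p⁻¹·unit`,
`φ₂((p)) = p·unit`), so the congruent forms are NOT ordinary at `𝔭` (consistently, Berger only claims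
crystallinity there, p. 9 L50–52) — useless for the seed, which needs an ordinary `r`.  VERDICT ON THE ITEM'S "INTENDED PROOF" (Harder class + Berger's `L^alg(0, χ_aχ_b⁻¹·)`
bound + Ribet raising at one `q` + torsion allowed): DEAD as a mechanism for the typed statement — it
produces, at best, mixed-oriented (split `p`) or non-ordinary (inert `p`) congruences, and torsion ones
give no `ℚ̄_p`-point (B1, `eigensystem_apply_eq_zero_of_nsmul_eq_zero`).  The only escape from the
inertial-type forcing in (i) is a nebentypus of full Teichmüller type at exactly ONE of the two places
above `p` (then inertial types no longer pin the orientation); no theorem in print produces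
Eisenstein-congruent forms of that shape.  (`ω|_{I_v} ≠ 1` at every `v ∣ p` here: `e(F_v/ℚ_p) ≤ 2 <
p - 1` for `p ≥ 5`, and for `p = 3` it fails only for `F = ℚ(√-3)`, where `p`-distinguishedness must
come from `χ̄_aχ̄_b⁻¹` alone.)

**D. What the typed seed needs in the genuine regime, and where a counterexample now has to live.**
A characteristic-0, parallel-weight, ordinary cuspidal eigensystem congruent to a PARALLEL-type
(degree 0/2, "Mazur-type") Eisenstein system `(χ_a, χ_b N^{k'-1})` at tame level `cond · q`.  For such
systems there is NO critical `L`-value (finite-order Hecke characters of a totally complex field: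
`L(χ, 1-k') = 0` for all `k' ≥ 2`, simple zeros from `Γ_ℂ`), so no Berger/Harder-type denominator
formula can even be stated in the usual shape (degree-2 denominators: Feldhusen, Bonn thesis 2005,
cited by Branchereau p. 2 as [Fel05] — not held, content unverified here); the known parallel-type
congruences are (a) TORSION — Eisenstein torsion in `H₁(Γ₀(𝔮), ℤ)` for `p ∣ N𝔮 − 1` coming from
`Γ₀(𝔮) ↠ (𝒪_F/𝔮)ˣ/𝒪_Fˣ`, which over `ℚ` is forced into characteristic 0 by torsion-freeness of
`H₁(Y₀(N), ℤ[1/6])` (Mazur) but over `F` need not lift (Calegari–Venkatesh phantom classes, §5), and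
(b) GEOMETRIC — base change of Mazur/Billerey–Menares newforms (pairs with `χ̄^c = χ̄`, uniform
orientation automatic) and `V_p` of elliptic curves / GL₂-type abelian varieties over `F` with an
`F`-rational `p`-isogeny (orientation = kernel étale-transverse at each `v ∣ p`).  These are exactly the
two live ideator cards (`Ideas/descend-raise-basechange.md`, `Ideas/ell-switch-geometric-seed.md`); the
Eisenstein-ideal/Hida line of the item text is not among the live mechanisms.  A COUNTEREXAMPLE must now
be: a genuine (`χ̄^c ≠ χ̄·`twist) `p`-distinguished pair over some `F` that arises from an admissible
`ρ` (itself, under Fontaine–Mazur, a parallel-weight ordinary cuspidal form of LARGE conductor) such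
that for EVERY prime `q` no parallel-weight ordinary cuspidal eigensystem of tame level `cond · q^∞`
is Eisenstein-congruent with the uniform orientation — by Calegari–Mazur rigidity (non-CM non-base-change
Hida families over `F` have finitely many parallel classical points) this is plausible for SOME data but
it quantifies over all `q` and all weights: not computable, not provable here.  The crux stays OPEN;
truth-value genuinely unknown in the genuine regime (contrast gen 1's "TRUE for pairs descending to ℚ").

**F. Route-level corollary of C (for the planner; outside this crux's verdict).** The same
dichotomy applies to the TARGET `ReducibleOrdinaryModular` and the ENGINE: both carry the uniform
orientation, so the Berger–Klosin `R = T` / modularity theorems over imaginary quadratic fields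
(JIMJ 2009, Math. Ann. 2011/2013), which deform the residual pairs of Berger's congruences (infinity
types `(z, z⁻¹)`; inertial types `(1, ω)` at `𝔭` and `(ω, 1)` at `𝔭̄` if C is read correctly), would be
theorems about the MIXED sector and NOT sub-cases of X as typed — against the route header's "known
sub-cases: BK09 minimal unique-extension"; this, and whether Akers 2025
(doi:10.1142/s1793042125500228) is uniform-type, must be confirmed at page level (not held /
search-degraded this cycle).  The uniform sector's known population is base change + CM-free geometric
(isogenous elliptic curves), i.e. the headline `FiveIsogenyEllipticCurves`.

**E. Cheap attacks re-run this cycle (for the record).** `lean check` of the extended file: rc 0,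
0 sorries, 0 warnings, axioms `{propext, Classical.choice, Quot.sound}` (checked on
`orientedFrame_diag_congr`).  No new junk found: the only place the pinning `hO : O = 𝒪_{ℚ̄_p}` is
USED in anything proved so far is (B) (integrality of `Q₀₀/Q₁₀`); without `hO` (an arbitrary valuation
subring `O ⊆ ℚ̄_p`, e.g. with a coarser valuation) the orientation inequality — stated with `Valued.v`,
not with `O` — no longer implies `Q₀₀/Q₁₀ ∈ O`, and the residual reading (B) can fail; so `hO` is
load-bearing for the MEANING of the clause (not a refutation handle: the crux fixes `O`).
Literature services: `searchd` unavailable (rc 75) during this cycle — OpenAlex/arXiv sweeps for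
2024–26 "Eisenstein level raising over imaginary quadratic fields" NOT run (search-degraded); galaxy
used for Branchereau; Berger read at page level from the held arXiv text.
-/


/-! ## §8 Gen 3, cycle 1 (2026-08-16) — the three registered lines read by the disprover; dihedral
exclusion; new literature (a genuine PARALLEL-type congruence exists in print); the first direct
computational probe of the HEART (genuine pairs) — kit jobs j012985 (`ℚ(i)`) / j012986 (`ℚ(√-2)`)

READ FIRST: §5 and §7 stand (same pins: no admissible `(ρ, ρ₀)` is constructible; `¬Concl` is a
non-existence theorem about `ℚ̄_p`-points of the constructed `𝕋(𝒰)`; `𝕋(𝒰)` was re-read this cycle: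
`levelCohomology U k i = groupCohomology (GL_n K) (Fun(GL_n(𝔸_f)/U, k))` is the GENUINE stacky
cohomology (Shapiro: `⊕_j H^i(Γ_j, k)` over the finite class set), so there is neither a junk point nor a
junk obstruction to exploit).  No `-- Targets`: `targets` / `stuck_stubs` are empty and no line is picked
(no `PICKED.md`).  What is new:

**A. Stub census of the three registered skeletons (cheap-kill scan; nothing bites, reasons recorded).**
`Lines/big-image-cousin.lean` (D1 `stub_dictionary`, S `stub_bigImageModularity`, K2 `stub_cousinSeed`,
K1 `stub_cousinSupply`, K3 `stub_descendedSeed`, R `stub_residualSeed`), `Lines/parallel-h2-eisenstein-symbol.lean`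
(`stub_window`, `stub_lift`, `stub_galois`, `stub_orientation`), `Lines/descend-raise-basechange.lean`
(S1–S6).  (i) EVERY stub except K1 and S1 has a non-constructible object among its hypotheses (an
admissible `(ρ, ρ₀)`, a `CuspidalAutomorphicRepData` — a genuinely irreducible `AutomorphicRepData`
realised on cusp forms, NOT junk-inhabitable —, an interior non-torsion Bianchi class, or an irreducible
oriented `ρ'` over `ℚ`) or concludes with an `IsPadicallyAutomorphic` non-existence — the §5 pins verbatim.
(ii) R and S6 are the crux RESTRICTED to the complement of the line's regime (certified there by
`residualSeed_of_crux` / `stub_complementRegimeSeed_iff`): no stronger than the crux, and they contain the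
heart (genuine pairs).  `stub_window` is the crux in cohomological clothing (mod-`𝔪` parallel Eisenstein
eigenvector in the image of the interior integral lattice at Hida level `U(r)` ⟺, by Deligne–Serre = `stub_lift`,
a characteristic-0 weight-2 congruence) — honest, load-bearing, not cheaper.  `stub_orientation` is ordinary
local–global compatibility at `v ∣ p` for EISENSTEIN-residual Bianchi eigenclasses — not in print
(Caraiani–Newton 4.2.15 is non-Eisenstein); a planner-level risk, not a refuter handle.  (iii) S1
(`stub_inertBMPrimeSupply`) is TRUE on paper exactly as typed (Chebotarev in the abelian field cut out by
`η̄ω` and `F`: `η̄ω` is even, `ε_F` odd, so `ε_F ∉ ⟨η̄ω⟩`; the Mazur corner `η̄ = ω`, `F ⊂ ℚ(ζ_p)` is the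
typed exclusion; the window is NOT among S1's hypotheses and is not needed for it).  S3 is bookkeeping and
provable.  (iv) JUNK QUANTIFICATION found and judged harmless: K1 quantifies over ALL valuation subrings `O`
(no pinning `hO`) and ALL `ρ₀` (no `Hyps`): `RealizedByCurve O ρ₀` pins the pair to an elliptic-type one
anyway, and for `O = ⊤` (`𝔪 = ⊥`) the congruences become equalities, only harder to satisfy; D1
(`Dictionary F p`) includes `p = 2` and its `π` is DECORATIVE for every constructible `r` (sums /
extensions of characters), for which the conclusion `∃ 𝒰, 𝒰.IsPadicallyAutomorphic r` is plausibly TRUE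
via the boundary of completed cohomology (e.g. `1 ⊕ 1 = 1 ⊕ ε·ε⁻¹`, `ε⁻¹` a continuous `p`-adic
character of the `p^∞` ray-class tower) — so no junk refutation of D1 either; `stub_galois` pins `tr` but
not `det` of `r'` (harmless: for `p` odd the residual charpolys follow from traces on `σ` and `σ²` by
continuity + Chebotarev).  (v) K1 is the one stub a COMPUTATION could falsify for a single datum (a local
obstruction on the twisted `X₁(p)`-conic: cusps covering `ℙ¹(k_λ)` at two small primes `λ ∉ S`, possible
only for `|k_λ| ≤ 3`, i.e. over `ℚ(√-2)` (`λ ∣ 2, 3`) or `ℚ(√-7)` (`λ ∣ 2`), never over `ℚ(i)`); not run —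
no line is picked, and a kill of K1 restricts a line, not the crux.

**B. Dihedral exclusion (paper lemma; informs ideators — CM abelian surfaces give NO admissible data).**
If `ρ ≅ Ind_{Γ_K}^{Γ_F} ψ` for some quadratic `K/F`, then `Hyps` fails: the oriented-ordinary clause at
`v ∣ p` (`θ₁^m = ε^{(k-1)m}`, `θ₂^m = 1` on inertia, `k ≥ 2`) forces `v` SPLIT in `K` (if `v` is inert or
ramified, the stable line makes `Ind_{D_w}^{D_v} ψ_w` reducible, `θ₁|_{I_w} = ψ_w`, `θ₂|_{I_w} = ψ_w^τ`, and
`ε` is `τ`-invariant, so `ε^{(k-1)m} = 1` on the finite-index subgroup `I_w ⊆ I_v` — impossible since `ε`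
has infinite order on every open subgroup of inertia), whereas residual reducibility forces `ψ̄ = ψ̄^τ`,
ratio of the residual characters `= ε_{K/F}`, and `p`-distinguishedness at `v` forces `ε_{K/F}|_{D_v} ≠ 1`,
i.e. `v` NOT split.  Not a Lean lemma (needs "`ε|_{I_v}` has infinite order", absent from the tree); it
confirms §3 (`PairSeed`): the only irreducible `ρ` one could hope to construct (inductions of characters)
are never admissible, and it is the Galois shadow of B-4 of `BarrierNotesIdeator1.md` (functorial
sources funnel to descended ratios).

**C. Literature (gen-3 sweep; OpenAlex/S2/arXiv rate-limited, zbMATH/Crossref/galaxy used).**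
(1) L. Combes, *Bianchi period polynomials: Hecke action and congruences*, Res. Number Theory (2024),
doi:10.1007/s40993-024-00513-w = arXiv:2306.10877, READ pp. 1–3, 11–14: for `K = ℚ(√-11)`, LEVEL ONE,
weight 12, the two GENUINE cusp forms `F₁, F₂` (coefficient field `ℚ(√81829)`) satisfy
`F₁ ≡ E₁₂ (mod 𝔭₁₇₃)` — proved via period polynomials (the modulus comes from the leading coefficient
`1/D`, `N(1/D) = 2^28·3^4·5^8·7^4·11^8·173^2`).  This CORRECTS the tone of §7D: a characteristic-0
PARALLEL-type ("straight", degree 0/2) Eisenstein congruence for a genuine Bianchi form DOES occur, at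
minimal level, sporadically; since `ζ_K(1-k) = 0` the governing quantity is non-critical (the leading term
`ζ_K^*(1-k) ∼ ζ(1-k)·L(ε_K, k)`, i.e. orders of `H²_ét(𝒪_K[1/p], ℤ_p(k))` / even `K`-groups), generically a
unit, sporadically not (`173` for `(K, k) = (ℚ(√-11), 12)`; `691` is the base-change congruence).  For the
seed: the datum `(1, ω^{11}) mod 173` is DESCENDED (ratio extends to `Γ_ℚ`), so no line's regime changes,
but `SeedMinimal` (§3) is not "believed false" uniformly any more — it holds sporadically, by a
non-`L`-critical mechanism no card uses.  (2) D. Fretwell–J. Roberts, *Newform Eisenstein congruences of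
local origin*, Ramanujan J. 64 (2024) = arXiv:2306.09842 (over `ℚ`), and *Hilbert modular Eisenstein
congruences of local origin*, JNT 280 (2026) = arXiv:2411.06987: the ONE-auxiliary-prime Eisenstein
congruence in characteristic 0 — precisely the seed's mechanism — is a theorem over `ℚ` and over totally
real fields (lifting mod-`𝔩` Hilbert eigenforms through `q`-expansions / ample line bundles); NO Bianchi
analogue is in print, and the lifting step is exactly what torsion obstructs over `F` (B-2).  (3)
Banerjee–Vishwakarma arXiv:2305.02436 (Eisenstein part of Bianchi homology), Dummigan–Spencer IJNT 2021
(local origin + automorphic induction, over `ℚ`): not bearing on the typed clause.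

**D. COMPUTATION — a straight-Eisenstein congruence census in the GENUINE regime (first direct probe of
the heart).**  Design (folder `census/`, `census2/`; pure Python, validated end-to-end): for
`F = ℚ(i)` (`p = 5 = (2+i)(2-i)` split) and `F = ℚ(√-2)` (`5` inert), `H₁(Γ₀(𝔫); 𝔽₅)` and `H₁(Γ₀(𝔫); 𝔽_ℓ)`
(`ℓ = 2^61-1`, char-0 proxy) of `Γ₀(𝔫) ⊂ PSL₂(𝒪_F)` from Fine's / Swan's presentations
(`⟨a,l,t,u | a², l², (al)², (tl)², (ul)², (at)³, (ual)³, [t,u]⟩`, resp. `⟨a,t,u | a², (ta)³, (au⁻¹au)², [t,u]⟩`,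
relators checked as matrices), via the Schreier graph on `ℙ¹(𝒪/𝔫)` and the cellular chain complex
(`H₁ ≅` cycles on non-tree edges modulo relator 2-cells; right-looking sparse elimination); Hecke
operators `T_w` on `H₁(𝔽₅)` by the transfer formula `T[γ] = Σ_j [M_j γ M_{σ(j)}⁻¹]`, `M_b = (1 b; 0 π)`,
`M_∞ = (π 0; 0 1)` (word problem by the Euclidean algorithm); the `PGL₂/PSL₂` involution
`d = diag(i,1)` resp. `diag(-1,1)` splits `H₁ = H₁⁺ ⊕ H₁⁻`, `H₁⁺ =` trivial-nebentypus `GL₂` cohomology.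
Sanity checks passed in every run: `D² = 1`, all `[T_w, T_{w'}] = [T_w, D] = 0`, index `= |ℙ¹(𝒪/𝔫)|`,
tree size.  CONTROLS (all exact): `ℚ(i)`: level `(11)`: `h₁ = 1`, eigenvalues of `BC(11a1)`
(`a_{1+i} = -2`, `a_{2±i} = 1`, `a_{(3)} = -5`, `a_{3±2i} = 4`, `a_{4-i} = -2`); level `(1+i)(7)`: `BC(14a1)`
(`a_{2±i} = 0`, `a_{(3)} = -2`, `a_{3±2i} = -4`, `a_{4-i} = 6` — visibly NON-Eisenstein mod 5);
`ℚ(√-2)`: level `1`: `h₁ = 1` exactly (`PSL₂(𝒪)^{ab} = ℤ ⊕ ℤ/6`) with the CM-type Eisenstein system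
`T_w ↦ Tr(λ_w)` in `H₁⁻` (as predicted by B-1's boundary computation), `(11) = 𝔭𝔭̄`: `BC(11a1)` in `H₁⁺`
plus rank-2 Eisenstein 5-TORSION with the same eigenvalues, `(√-2)(7)`: `BC(14a1)`.  DATA: the smallest
genuine `p`-distinguished pairs of weight-(2,1) inertial type, `(χ̄_a, χ̄_b) = (χ^j, ωχ^{-j})`, `χ` the
quartic character of conductor `𝔮₁₇ = (4+i)` resp. `(3+2√-2)` (`χ(x) ≡ x⁴ mod 𝔮₁₇`, values in `μ₄ ⊂ 𝔽₅^×`),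
`j = 1, 3` GENUINE (ratio `ωχ^{∓2}` not `c`-invariant; elliptic type = the `ell-switch` / `big-image-cousin`
population, twist-needing), `j = 2` the DESCENDED control (ratio `ω`; at `q = (11)` inert in `ℚ(i)` the
twist `BC(11a1) ⊗ χ²` MUST appear).  For these pairs `det = ω`, so the weight-2 realisation of `Concl` with
`(k', m') = (2, 1)` is a TRIVIAL-character cuspidal eigenform on `Γ₀(𝔮₁₇² · q)` (conductor exponent 2 at
`𝔮₁₇`: ramified principal series), `5`-ordinary with unit root `≡ χ^j(Frob_v)` AUTOMATICALLY (the
unramified constituent), and the typed congruence is `a_w ≡ χ^j(w) + N(w)χ^{-j}(w) (mod (2+i))`, at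
`w ∣ 5`: `a_v ≡ χ^j(Frob_v) ≠ 0` (= ordinarity + orientation).  Every `𝔽₅`-RATIONAL eigensystem in `H₁⁺`
at these levels is cuspidal or torsion (all CM-type Eisenstein classes involve an order-16 character of
`(𝒪/𝔮₁₇^k)^×`, `χ(i) = ∓i`, whose values generate `𝔽_{5^4}`).  VERDICT LOGIC per level: `m_j =` dimension
of the joint generalised target eigenspace in `H₁⁺(𝔽₅)`; `t⁺ = h₁⁺(𝔽₅) - h₁⁺(𝔽_ℓ)` (= rank of the
5-torsion image); `m_j > t⁺` ⟹ a CHARACTERISTIC-0 eigenform of level dividing `𝔮₁₇²q` is congruent to the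
straight system (pigeonhole + Deligne–Serre) — the seed HOLDS for that datum with that `q` (modulo the
dictionary D1); `0 < m_j ≤ t⁺` ⟹ ambiguous (possibly absorbed by torsion, B-2/B-3); `m_j = 0` ⟹ level
`𝔮₁₇²q` is DEAD for weight 2 / level prime to 5 (rigorous; higher `k'` ⟺ level `5^r` with nebentypus by
Hida, not covered).  Levels: `𝔮₁₇²·q` for all primes `q` with `N(q) ≤ 150` (`ℚ(i)`, 35 levels, index up to
`306·150`) resp. `≤ 140` (`ℚ(√-2)`), plus `𝔮₁₇²`, `𝔮₁₇³`, and over `ℚ(√-2)` both primes above `113` (the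
`ell-switch` card's certified cousin `E_T`, `T = -9-4√-2`, kit j008657, predicts a `j ∈ {1,3}` char-0 hit at
exactly one of them — the positive control for genuine detection).  RESULTS: see §8E (filled in when the
jobs return; the jobs attach their manifests to the item as evidence).

**E. RESULTS (interim, 2026-08-16T05:50Z; jobs j012985 `ℚ(i)`, j012986 `ℚ(√-2)` still running, j013447 `q²`-levels and
j013490 Hida-direction `·(5)`-levels running; final table in v4).**  A SHARPENING FIRST: for these data NO abelian/degree
(Shimura-type) class carries the straight system mod 5 — the degree characters of `Γ₀(𝔮₁₇²q)` factor through
`(𝒪/𝔮₁₇²q)^× ⊗ ℤ/5`, non-zero only for `5 ∣ N(q) - 1` and then reducing to the `(1, ω)` system, never to `(χ^j, ωχ^{-j})`,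
`χ` of order 4 — so ANY target hit, even one inside the torsion count `t⁺`, is a CUSPIDAL straight class (torsion or char 0);
this is unlike the ideators' Toy 1 (`(1, ω)` at prime level), where the forced class was abelian.  `ℚ(i)` so far (25 levels,
all `q` with `N(q) ≤ 89` incl. `q ∣ 5`, plus `𝔮₁₇²`, `𝔮₁₇³`; controls exact): target dimension `0` for `j = 1, 2, 3` at EVERY
level — no cuspidal straight class at all, torsion or characteristic 0, although 5-torsion in `H₁⁺` is frequent (`t⁺` up to 12)
and although many of these `q` satisfy the level-raising sign condition S+ (`χ^{2j}(q) ≡ N(q)^{0 or 2}`: `q = 1+i, 2+i, 3±2i,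
4-i, 5-2i, 6±i, 5-4i, …`); the `+` parts are mostly the 8 old CM-type Eisenstein classes of level `𝔮₁₇²` (an `𝔽₅`-irrational
block) plus base changes (`BC(17a1)` at `𝔮₁₇²(4-i)`, recognised by its eigenvalues) and a few genuine non-congruent newforms.
The descended control `j = 2` at `q = (11)` (index 37 332) has not run yet.  `ℚ(√-2)` so far (14 levels, `N(q) ≤ 27`): ONE
ambiguous hit — level `𝔮₁₇²·(3-√-2)` (`N(q) = 11`, split): `m₁ = m₃ = 1 ≤ t⁺ = 3` (a cuspidal straight class for the GENUINE
data, torsion or char 0; its conjugate level `𝔮₁₇²·(3+√-2)` has none — genuinely asymmetric, as a non-base-change phenomenon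
must be); stage-2 certification (integer characteristic polynomials by multi-prime CRT) queued as j014197.  The `N(q) = 113`
cousin control has not run yet.

**G. `-- Targets` (unofficial: no line is picked) — ONE STUB KILLED ON PAPER, and the "orphan datum".**
(1) `stub_cousinSupply` (K1 of `Lines/big-image-cousin.lean`: `(p = 5 ∨ p = 7) → RealizedByCurve O ρ₀ → Cousin O ρ₀`,
universally over `F`, `O`, `ρ₀`) is FALSE as typed — witness `(F, p, ρ₀) = (ℚ(√-7), 7, diag(1, ω̃))`: `2 = λλ̄`
splits in `F` with residue fields `𝔽₂`; `RealizedByCurve` holds (any `E/F` with an `F`-rational 7-torsion point,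
e.g. `26b1/F`), but a COUSIN must have an `F`-rational point of order 7 (`a ≡ 1 mod 7`) and good reduction at every
place outside `{q} ∪ {v ∣ 7}`; the HASSE BOUND `|Ē(𝔽₂)| ≤ 5 < 7` forces bad reduction at BOTH `λ, λ̄` — two places —
contradiction.  The same obstruction kills genuine `p = 7` data over any `F` with `2` split whenever
`χ̄_a(Frob_λ), χ̄_a(Frob_λ̄) ∈ {±1}`; for `p = 5` no local obstruction exists anywhere (checked: exactly 2 of the
`|k_λ| + 1 ≥ 3` residue points of the twisted `X₁(5)`-conic are cuspidal).  Class: stub-MISSTATED; repairs: restrict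
to `p = 5`, or to `(F, 7)` with `2` not split, or add "no two residually-unramified norm-2 places with
`χ̄_a(Frob) = ±1`".  Not Lean-landable (needs explicit `E[7]` with its Galois action); filed as evidence
`stubs/stub_cousinSupply.md` + `Negative-notes/stub_cousinSupply.md`.  (2) THE ORPHAN DATUM `(1, ω)` over
`ℚ(√-7)`, `p = 7`: conceded by `descend-raise-basechange` (Mazur corner: `F ⊂ ℚ(ζ₇)`, every `M ≡ 1 (7)` splits),
Hasse-obstructed for `big-image-cousin` (above), unspecific for `parallel-h2`; yet it ARISES from admissible `ρ`
(`V₇(E)` for any non-CM `E/F` with an `F`-rational 7-torsion point and good reduction at `(√-7)`: `7 ∣ |Ē(𝔽₇)|`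
forces `a_v = 1`, so `E` is ordinary at `v` with unit root `≡ 1 = χ̄_a` — oriented —, `p`-distinguished as
`ω|_{I_v} ≠ 1`, irreducible by Serre) — the sharpest available test of the crux.  ATTACK (folder `orphan/orphan.py`:
`H₁(Γ₀(N); 𝔽₇)` of `Γ₀(N) ⊂ PSL₂(ℤ) = ⟨a,t | a², (at)³⟩` — torsion-free at 7, so mod-7 multiplicities ARE char-0
multiplicities —, complex conjugation `diag(-1,1)` (Eisenstein classes sit in the `−` part of HOMOLOGY, cusp forms in
both), `T_p/U_p` by transfer; controls exact: `N = 11, 13`: 0; `26`: 1 (`26b1`); `29`: 1 (Mazur, `7 ∣ num((29-1)/12)`);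
`58`: 2 old; `49`: a trace-only hit killed by `U₇ ≠ 1`, as it must be — `49a1` has CM by `F`, cf. B): base-change supply
for the orphan = classical weight-2 newforms of level `7^b ℓ^a`, `ℓ ≡ 3, 5, 6 (mod 7)` (inert in `F`), with
`a_p ≡ 1 + p (mod 𝔭 ∣ 7)` and `a₇ ≡ 1` / `U₇ ≡ 1` (ordinary + oriented; weights `k' ≡ 2 (mod 6)` are covered by Hida at
level `7N`).  RESULT: level `169 = 13²` carries THREE such characteristic-0 cuspidal eigensystems (none at levels 1, 13;
no CM possible at 169); `13 ≡ -1 (mod 7)` is inert in `ℚ(√-7)`, so base change gives an irreducible, ordinary,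
oriented, parallel-weight-2, 7-adically automorphic `r` of tame level `(13)²` — ONE place `q = (13)`: the seed HOLDS for
the orphan (modulo the dictionary D1).  Also `7·13² = 1183`: 5 systems (3 old + 2), `49·13 = 637`: 1.  Mechanism (in NO
card): Eisenstein congruences at level `ℓ²`, `ℓ ≡ -1 (mod p)` — the cuspidal subgroup of `J₀(ℓ²)` has order divisible by
`(ℓ²-1)/24` (Ling 1997), `7 ∣ (169-1)/24` —, i.e. supercuspidal level raising of `1 ⊕ ω` to `ℓ²` with `ℓ` INERT in
`F`.  REPAIR HINT for planners: in the Mazur corner replace "`M ≡ 1 (p)`, level `NM`" by "`M ≡ -1 (p)` inert in `F`,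
level `NM²`" (such `M` exist for `F = ℚ(√-p)`: `(−p/M) = −1`).  FULL SCAN (kit j013348, done: 111 levels `7^b ℓ^a ≤ 2471`, `ℓ ≡ 3,5,6 (mod 7)`, + controls; 0 assertion failures): NEW oriented
(`U₇ = 1` / `a₇ ≡ 1`) cuspidal eigensystems with `ρ̄^ss = 1 ⊕ ω₇` occur EXACTLY at `N = 7ℓ` for EVERY `ℓ ≡ -1 (mod 7)` in range
(`ℓ = 13, 41, 83, 97, 139, 167, 181, 223, 251, 293, 307, 349`: one system each, three at `7·349`) and at `N = ℓ²` for
`ℓ ≡ -1 (mod 7)` (`13²`, `41²`: three systems each), and NOWHERE for `ℓ ≡ 3, 5 (mod 7)` (`7ℓ`, `ℓ²`, `49ℓ`, `7ℓ²` all empty of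
new systems; `49ℓ`, `7ℓ²` only old ones; pure powers `7, 49, 343, 2401`: none, as Kummer predicts).  Since `ℓ ≡ -1 (mod 7)`
⟹ `(−7/ℓ) = (ℓ/7) = -1` ⟹ `ℓ` INERT in `ℚ(√-7)`, every such `ℓ` gives the orphan a seed with ONE auxiliary place `q = (ℓ)`:
from level `7ℓ` a form Steinberg at `ℓ` and at `7` (`U₇ = 1`: ordinary, unit root `1 = χ̄_a`, oriented), tame level `(ℓ)¹`; from
`ℓ²` a supercuspidal one, tame level `(ℓ)²` (consistent with the cuspidal group of `J₀(ℓ²)` of order divisible by `(ℓ²-1)/24`,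
Ling 1997, and with Ribet–Yoo admissibility at level `pℓ`, `ℓ ≡ -1 mod p`).  REPAIR HINT, final form: in the Mazur corner
(`F = ℚ(√-p)`, datum `ν̄ ⊗ (1, ω)`) take `M ≡ -1 (mod p)` — automatically inert in `F` — and level `pM` (or `M²`) instead of
Billerey–Menares' `M ≡ 1`, level `M`; numerically the supply is 12/12.  VERDICT OF THE ATTACK: the crux survives its sharpest
concrete instance; the one-`q` clause is met there at level `q¹` (Steinberg) and `q²`.

**F. What a counterexample must look like now (update of §7D).**  Unchanged in logic — a genuine
`p`-distinguished pair all of whose straight realisations need `≥ 2` auxiliary places — but the census makes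
the question QUANTITATIVE for the first time: for the smallest genuine pairs over `ℚ(i)` / `ℚ(√-2)` it
lists, prime by prime, which single auxiliary `q` carry a weight-2 straight congruence in characteristic 0,
which carry it only in 5-torsion (the B-2 toll), and which carry none; a pair with NO char-0 hit for all
`N(q) ≤ 150` would be the first concrete candidate counterexample (to be pursued in weight `k' > 2` /
`5`-power level), a pair with hits confirms the ideators' heuristic B-3 ("sporadic but present").
-/

end Summit.Langlands.Langlands.Cruxes.EisensteinProModularSeed.Disproof
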